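import Literature.MathematicalPhysics.QuantumFieldTheory.Dimock2011to13.HolePolymerKeyBounds
import Literature.MathematicalPhysics.QuantumFieldTheory.Dimock2011to13.UltralocalFactorization
import Literature.Probability.LatticeModels.ClusterExpansionKPBound

/-!
# Dimock, *The renormalization group according to Balaban* II, Appendix F THEOREM F.1 `\label{cluster3}` — the cluster
# expansion with holes (gog2)∕(sunshine) AT A FIXED FIELD, PROVED on the torus polymer model: the Kotecký–Preiss
# condition of the hard-core gas of Ω-parts DERIVED from (simplon), (otter), (keykey2) and a Lemma-E.2-type summability
# over disconnected Ω-parts, the `H^#` bound obtained from the tree's PROVED Kotecký–Preiss estimate, and (v1.1) the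
# INTEGRATION STEP 2 over an ultralocal measure — THEOREM F.1 with every step of its printed proof typed

**Citation header (reproduction of PUBLISHED work; template of the Bałaban lattice Yang–Mills cell).**
J. Dimock, *The renormalization group according to Balaban II. Large fields*, J. Math. Phys. **54** (2013) 092301
(= arXiv:1212.5562v2) [Dimock2013BalabanII], Appendix F `\section{cluster expansion with holes} \label{fancycluster}`
TeX L6968–7083: the setting (gog1) L6973–6981, THEOREM F.1 `\label{cluster3}` L6984–6997 with (gog2) L6990–6992 and
(sunshine) L6994–6996, the *"local influence"* remark L7000, the proof L7004–7083 ((keykey1)∕(keykey2) L7007–7014,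
Ω-connectedness L7016–7021, the Mayer expansion L7025–7035, (otter) L7037–7044, (simplon) L7046–7049, step 2 L7051–7061,
the exponentiation (hstar) L7063–7073, the last sentence L7076–7077); App. E LEMMA E.2 `\label{kumquat}` L6833–6912.
J. Dimock, *… I. Small fields*, Rev. Math. Phys. **25** (2013) 1330010 (= arXiv:1108.1335v2) [Dimock2013], App. B THEOREM
`\label{cluster}` L3178–3194 and its proof step 4 L3406–3506 (the convergence of (hstar)).  TeX line numbers refer to
the arXiv sources held by the cell (`inputs/files/dimock/src/1212.5562/1212.5562.tex`, 7217 lines;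
`…/1108.1335/1108.1335.tex`); every quotation below was read there this session.  Dimock's papers are published and
refereed and are the cell's TEMPLATE, not manuscripts under audit; no quantity of the Bałaban series is touched.

**What the paper prints (verbatim).**  THEOREM F.1 (L6984–6997): *"Let c_0 = 𝒪(1) be sufficiently small, let H_0 ≤ c_0,
let κ ≥ 3κ_0 + 3, and suppose  |H(X,Φ′,Φ)| ≤ H_0 e^{−κ d_M(X, mod Ω^c)}  X ∈ 𝒟_k(mod Ω^c)  on the support of μ_Λ. Then
Ξ = exp( Σ_{Y ∈ 𝒟_k(mod Ω^c), Y ∩ Λ ≠ ∅} H^#(Y,Φ′) )  (gog2)  where H^#(Y,Φ′) depends on Φ′ only in Y and satisfies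
|H^#(Y,Φ′)| ≤ 𝒪(1) H_0 e^{−(κ − 3κ_0 − 3) d_M(Y, mod Ω^c)}  (sunshine)"*.  Proof, L7004–7006: *"This closely follows the
proof of the standard cluster expansion. It is exposed in Appendix B in part I, to which we refer for more details."*;
L7051–7061 (step 2): *"Because the Y_j ∩ Ω are disjoint, the Y_j ∩ Λ are disjoint. Since K(Y,Φ′Φ) depends on Φ only in
Y_i ∩ Λ, and because fields at different sites are independent random variables  ∫ (Σ_{{Y_j}} Π_j K(Y_j,Φ′,Φ)) dμ_Λ(Φ) =
Σ_{{Y_j}} Π_j K^#(Y_j,Φ′)  where K^#(Y,Φ′) = ∫ K(Y,Φ′,Φ) dμ_Λ(Φ) again satisfies the bound (simplon)."*; L7063–7077: *"Next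
we exponentiate the sum and get  Σ_{{Y_j}} Π_j K^#(Y_j) = exp(Σ_Y H^#(Y)) … H^#(Y) = Σ_{n=1}^∞ (1/n!) Σ_{(Y_1,…,Y_n): ∪_i
Y_i = Y} ρ^T(Y_1,…,Y_n) Π_i K^#(Y_i)  and ρ^T(Y_1,…,Y_n) is now defined so it vanishes if the Y_j are not Ω-connected.
Finally, with some further analysis, the bound on K^#(Y) and the estimates (keykey1), (keykey2), (otter), (simplon)
lead to the convergence of the series and the estimate (sunshine)."*  Part I App. B step 1 (L3273): *"Furthermore we
assume c_0 is small enough so that 2c_0K_0κ_0e^{κ−κ_0} ≤ 1. (So c_0 does depend on κ.)"*; step 4 (L3406, L3502–3506):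
*"We now demonstrate that under our assumptions the series (hstar) defining H^# converges. … |H^#(Y)| ≤ e^{−(κ_2 −
2κ_0 − 1) d_M(Y)} Σ_{n=1}^∞ (𝒪(1)H_0)^n ≤ 𝒪(1) H_0 e^{−(κ_2 − 2κ_0 − 1) d_M(Y)}  provided H_0 ≤ c_0 and c_0 is
sufficiently small."*

**Why this module.**  TEMPLATE.md §4.2 row «D2 §3.14 cluster expansion with holes»: after `HolePolymerKeyBounds` (gen 36:
(otter), (keykey1), (keykey2) by name, (simplon) on the torus) the row's remaining kernel gap was THEOREM F.1 itself —
the exponentiation (gog2) and the `H^#` bound (sunshine).  The lineage's App. B kernel `MayerExpansion` §5 proves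
`exp(Σ_X H(X)) = exp(Σ_Y H^#(Y))` GIVEN the finite-volume Kotecký–Preiss condition on Dimock's regrouped activities
`K(Y)` (reading (v) there: the tree's PROVED Kotecký–Preiss theorem replaces the printed formal-series∕Cayley road of
part I step 4), and the tree PROVES the Kotecký–Preiss estimate (4) (`LatticeModels.touchSum_le_of_kp`,
`ClusterExpansionKPBound`).  This module supplies, on the torus carrier with holes `Θ` (= the cubes of Ω^c), the
Kotecký–Preiss condition of the hard-core gas of Ω-PARTS `V = Y ∩ Ω` from (simplon) and derives (gog2) and (sunshine)
with every constant explicit — the *"further analysis"* of L7076–7077 in the Kotecký–Preiss form.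

**What is reproduced here (kernel-checked, zero `sorry`; imports this lineage's `HolePolymerKeyBounds` and the tree's
`LatticeModels.ClusterExpansionKPBound` only).**
* Part 1 — GRAPHS FOR ARBITRARY Ω-PARTS: every non-empty torus family `V` has a connected polygonal graph in the
  universal cover meeting a lift of each of its cubes (`exists_tCover_univ`, a star through the corners of the
  standard lifts), so that `coverLen univ V` (the torus Steiner length in which (simplon) decays) has a non-empty class
  for every Ω-part — Ω-parts `Y ∩ Ω` are NOT connected in general (L6930: *"Although X is connected, Y need not be"*).
* Part 2 — (otter) FOR Ω-PARTS: for a finite family `𝒞` of non-empty torus families which is a CLUSTER for the hard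
  core "intersect" (`LatticeModels.IsPolymerCluster MayerExpansion.Inc`, = the printed *"Ω-connected"* for Ω-parts,
  L7016–7021), `coverLen univ (∪𝒞) ≤ Σ_{V∈𝒞} coverLen univ V + (|𝒞| − 1)` (`coverLen_biUnion_le_of_isPolymerCluster`;
  the stitching induction of L7041–7044 through `HolePolymerKeyBounds.coverLen_union_le_of_common`).
* Part 3 — LEMMA E.2-TYPE SUMMABILITY OVER DISCONNECTED Ω-PARTS: for any cube `c` and ANY finite family `𝒱` of torus
  families through `c`, `Σ_{V∈𝒱} e^{−κ·coverLen univ V} ≤ K₁(d)` for `κ ≥ κ₁(d)` (`sum_exp_coverLen_le`: the animal of a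
  re-sheeted near-optimal graph, fibre count `2^{#A}`, the tree's connected-animal count — the route by which the sibling
  `HoleSummability` proved (sumsum); the print's Lemma E.2 sums `e^{−aℓ′_M(Y)}` over disconnected `Y ∋ □` by Cayley's
  formula, L6833–6912), and its (keykey1)-shape `sum_exp_coverLen_inter_le` (`Σ_{V′ ∩ V ≠ ∅} ≤ K₁(d)|V|`).
* Part 4 — SUPPORTS ON `Pol` ONLY: congruence of `MayerExpansion.covers ∕ K ∕ unions ∕ Hsharp` in the support map on
  `Pol` (`covers_congr`, `K_congr`, `unions_congr`, `Hsharp_congr`) and **`cexp_sum_eq_cexp_sum_Hsharp_of_pol`** = the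
  App. B kernel's `cexp_sum_eq_cexp_sum_Hsharp` with its support hypothesis required on `Pol` only (the kernel asks
  `∀ X, (supp X).Nonempty`; with `supp X := X ∖ Θ` this fails at `X = ∅ ∉ Pol` — repaired by modifying `supp` off `Pol`).
* Part 5 — THE KOTECKÝ–PREISS CONDITION OF THE GAS OF Ω-PARTS (the heart): with size `a(V) = θ|V|` (`kpSize`) and decay
  `d(V) = δ(coverLen univ V + 1)` (`kpDecay`), `δ = κ − κ₀ − 2 − 4·2^d − κ₁(d)` (`delta`), `θ = 2e·K₁(d)²κ₀·e^{4·2^d+δ}·H₀`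
  (`theta`): for polymers with holes `Pol` (non-empty, face-connected, `DMod Θ X`, non-empty Ω-part) and activities
  `‖a X‖ ≤ 2H₀e^{−κ d_M(X, mod Θ)}`, `max(κ₁(d), 4·2^d) ≤ κ₀`, `δ ≥ 0`, `0 ≤ H₀`, `2H₀K₁(d)κ₀e^{κ−κ₀} ≤ 1`, `θ ≤ 1`:
  **`kp_sum_le`** `Σ_{V′ Ω-meets V} ‖K(V′)‖e^{a(V′)+d(V′)} ≤ a(V)` for every Ω-part `V` ((simplon) = `simplon_torus`,
  (keykey2) = `ninety_of_keykey2`, Part 3), hence **`isKPVolume_holes`** (`LatticeModels.IsKPVolume`) and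
  **`touchSum_le_holes`** (the tree's PROVED estimate (4): `Σ_{𝒞 ι V} ‖Φ^T(𝒞)‖e^{d(𝒞)} ≤ θ|V|`).
* Part 6 — THEOREM F.1 AT A FIXED FIELD: **`norm_Hsharp_le`** (`‖H^#(V)‖ ≤ θ|V|e^{−δ(coverLen univ V+1)}`: off clusters
  `Φ^T = 0` by the tree's `truncatedWeight_eq_zero_of_kp`, on clusters Part 2 gives `d(𝒞) ≥ d(V)`), **`sunshine`**
  (`‖H^#(V)‖ ≤ C♯(d,κ₀)·H₀·e^{−(κ−3κ₀−3)·coverLen univ V}`, `C♯ = 8e·2^d·K₁(d)²·κ₀·e^{4·2^d}` = `Csharp`, for EVERY Ω-part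
  `V`, under `max(κ₁(d),4·2^d) ≤ κ₀`, `3κ₀ + 3 ≤ κ`, `0 ≤ H₀` and the single smallness `2e·K₁(d)²·κ₀·e^{κ}·H₀ ≤ 1`),
  **`gog2`** (`exp(Σ_{X∈Pol} H(X)) = exp(Σ_V H^#(V))` for `‖H(X)‖ ≤ H₀e^{−κ d_M(X, mod Θ)}` on `Pol`, `H₀ ≤ log 2`, same
  parameter regime), `sunshine_of_H` (the bound for these activities), and the NON-VACUITY of the parameter regime
  (`regime_nonempty`: for every `d` there are `κ₀, κ, H₀ > 0` satisfying all hypotheses).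
* Part 5a (v1.1) — THE SAME FOR ANY ACTIVITY WITH THE (simplon)-TYPE BOUND: `kp_sum_le_of_norm_le`,
  `isKPVolume_of_norm_le`, `touchSum_le_of_norm_le`, `norm_Hsharp_le_of_norm_le`, **`sunshine_of_norm_le`** for an
  arbitrary activity `w` on the Ω-parts with `‖w(V)‖ ≤ 2eK₁(d)κ₀H₀e^{−(κ−κ₀−2)·coverLen univ V}` (Part 5∕6's theorems are
  the instances `w = K`, `norm_K_le_of_mem_unions` = `simplon_torus`); this is the form that serves the integrated `K^#`.
* Part 7 (v1.1) — STEP 2 TYPED, THEOREM F.1 WITH ITS INTEGRATION: fields `Φ : TPt d N → E` (one variable per unit cube,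
  values in an ARBITRARY measurable space `E`), the ultralocal measure `μ_Λ = ⊗_c ν_c` (`MeasureTheory.Measure.pi ν`, each
  `ν_c` a probability measure), `H(X, ·)` measurable and depending on the field only through the cubes of `X ∩ Λ`, `Λ ∩
  Θ = ∅`; `Kfield` (= `K(Y,Φ′,Φ)`), `Ksharp` (= `K^#(Y,Φ′) = ∫K dμ_Λ`), `measurable_Kfield`, **`dependsOn_Kfield`** (*"K
  depends on Φ only in Y ∩ Λ"*, L7035), `abs_Kfield_le` ((simplon) at each field), **`abs_Ksharp_le`** (*"K^# again
  satisfies the bound (simplon)"*, L7061; `UltralocalFactorization.abs_integral_le_of_abs_le`), `famD_congr`,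
  `exp_sum_eq_mayer_of_pol`, `sum_famD_prod_eq_polymerPartitionFunction` (any activity),
  **`integral_exp_sum_eq_sum_famD`** (steps 1–2: `∫exp(Σ_X H(X,Φ))dμ_Λ = Σ_{{Y_j}} Π_j K^#(Y_j)` by the Mayer expansion at
  each field, `MeasureTheory.integral_finsetSum` and the factorisation `UltralocalFactorization.integral_prod_polymers` —
  *"fields at different sites are independent random variables"*), **`gog2_integrated`** (`Ξ = ∫exp(Σ_{X∈Pol}
  H(X,Φ))dμ_Λ(Φ) = exp(Σ_V H^#(V))` with `H^#` built on the INTEGRATED activities `K^#`) and **`sunshine_integrated`**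
  (`‖H^#(V)‖ ≤ C♯(d,κ₀)·H₀·e^{−(κ−3κ₀−3)·coverLen univ V}`), same parameter regime as Part 6.

**Readings ∕ divergences (declared).**  (i) FIXED FIELD (Parts 5–6) AND INTEGRATED (Part 7, v1.1): Part 6 is F.1 for a
Dirac `μ_Λ` (the module's `K` in the rôle of `K^#`); Part 7 types step 2 as well, over the model of reading (vii), so that
every step of the printed proof (Mayer expansion, integration∕factorisation, exponentiation, convergence with (sunshine))
is kernel-checked on the cell's carrier.  (ii) INDEXING BY Ω-PARTS (reading (vi) of
`HolePolymerKeyBounds`): the gas exponentiated is that of the Ω-parts `V = Y ∩ Ω` (`MayerExpansion.unions (· ∖ Θ) Pol`)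
with Dimock's hard core *"Ω-disjoint"*; `H^#` is indexed by `V` and decays in the torus Steiner length `coverLen univ V`
(≤ `d_M(Y, mod Θ)` for every `Y` with `Y ∖ Θ = V`), the print indexes by `Y`.  (iii) ROUTE: Kotecký–Preiss [KP86] in
place of the printed tree-graph bound + Cayley (part I L3409–3490) — a different published road to (sunshine), declared
in `MayerExpansion` reading (v); consequently the decay bookkeeping is `d(𝒞) = Σ_{V′∈𝒞} δ(coverLen V′ + 1) ≥ δ(coverLen
(∪𝒞) + 1)` (Part 2) instead of the printed extraction via (clams).  (iv) CONSTANTS are explicit and not optimal: the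
print's *"c_0 = 𝒪(1) sufficiently small"* is `2e·K₁(d)²·κ₀·e^{κ}·H₀ ≤ 1` — depending on `κ` exactly as part I App. B
step 1 says (*"(So c_0 does depend on κ.)"*, L3273) — while the `𝒪(1)` of (sunshine), `C♯(d, κ₀)`, depends on `d` and
`κ₀` only (print: *"The constant 𝒪(1) depends only on the dimension"*, part I L3193, `κ₀` being a dimensional constant
there); the rate loss `3κ₀ + 3` is met under `κ₀ ≥ max(κ₁(d), 4·2^d)` (our `δ − 1 ≥ κ − 3κ₀ − 3`).  (v) CARRIER: the
torus polymer model of `TreeLengthTorus`∕`ThreeSortedResummation` (unit cubes, `M = 1`, sup metric, graphs in the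
universal cover — conventions D-pv22.1 ∕ D-pv22g2.1), holes `Θ` = the family of cubes of Ω^c, `Y ∩ Ω = Y ∖ Θ`.  (vi) The
restriction *"Y ∩ Λ ≠ ∅"* of (gog1)∕(gog2) is the choice of `Pol` and is not modelled separately.  (vii) FIELDS (Part 7): one field
variable per unit cube of the torus with values in an arbitrary measurable space `E` (a cube of Dimock's unit lattice
carrying `M^d` real sites is the case `E = ℝ^{M^d}`; the cell's carrier has `M = 1`), `μ_Λ` the product of probability
measures `ν_c` over ALL cubes (the cubes outside `Λ` carry dummy variables on which nothing depends — equivalent to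
Dimock's `Φ : Λ → ℝ`), *"H(X,Φ′,Φ) depends on Φ′, Φ only in X"* (L6981) with `Φ` living on `Λ ⊂ Ω` (L6973) read as
`DependsOn (H X) (X ∩ Λ)` with `Λ ∩ Θ = ∅`; `Φ′` is fixed and absorbed into `H`; the bound *"on the support of μ_Λ"* is
taken for every `Φ` (as in `UltralocalFactorization`, reading (ii) there).

**What is NOT claimed.**  The *"local influence"* remark as a theorem about `H^#` (it is definitional: `Hsharp … V`
is a sum over sub-families of Ω-parts inside `V`); the dependence of `H^#(Y,Φ′)` on `Φ′` only in `Y` (`Φ′` is absorbed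
into `H`); analyticity in `Φ′`; LEMMA 3.18 and the
(t,u)-interpolation of §3.14; THEOREM F.1 for Dimock's literal continuum `d_M(·, mod Ω^c)` (asserted only through the
cell's model `torusTreeLenMod`∕`coverLen`); anything of B1–B16 (the row's Bałaban side — B13 §2, B16 §1 (1.90)–(1.98) —
untouched).  NOT summit progress; NOT a statement about any Bałaban paper; NOT continuum; NOT Clay.  NEW leaf (v1); imports
`…Dimock2011to13.HolePolymerKeyBounds` (this lineage; hence `ResummationOperation`, `HoleSummability`,
`ThreeSortedResummation`, `ClusterActivityBound`, `MayerExpansion`, unit b01's `B14RelTreeLength`),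
`…Dimock2011to13.UltralocalFactorization` (this lineage, Mathlib-only: part I step 2; v1.1) and
`Literature.Probability.LatticeModels.ClusterExpansionKPBound` (the tree's proof of [KP86] (4)); no Summits import; no
cycle; modifies nothing; no named fact (net debt 0).  Unit `b2b-balaban-template` gen 37 (journal CLAIMs
D2-THMF1-KERNEL (v1), D2-THMF1-STEP2-KERNEL (v1.1)); cell records TEMPLATE.md §4.2 row «D2 §3.14», §15.2; GAPS C-tmpl37-1
(v1), C-tmpl37-2 (v1.1).

**Version.**  v1 (gen 37 round 1, p219548): Parts 1–6.  v1.1 (gen 37 round 2, same seat, 2026-08-20): + Part 5a (the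
Kotecký–Preiss bookkeeping for an arbitrary activity with the (simplon)-type bound; Part 5∕6's `kp_sum_le`,
`isKPVolume_holes`, `touchSum_le_holes`, `norm_Hsharp_le`, `sunshine` re-proved as its instances — statements
byte-identical, `one_le_K₁`∕`smallness_of_single` moved up unchanged) + Part 7 (step 2 typed: `Kfield`, `Ksharp`,
`gog2_integrated`, `sunshine_integrated`) + the import of `UltralocalFactorization`; every v1 declaration keeps its name
and statement.
-/

noncomputable section

open Real Finset
open Literature.MathematicalPhysics.QuantumFieldTheory.Balaban1983to89
open Literature.MathematicalPhysics.QuantumFieldTheory.Balaban1983to89.B13ScaleTransfer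
open Literature.MathematicalPhysics.QuantumFieldTheory.Balaban1983to89.TreeLength
open Literature.MathematicalPhysics.QuantumFieldTheory.Balaban1983to89.TreeLengthTorus
open Literature.MathematicalPhysics.QuantumFieldTheory.Balaban1983to89.TreeLengthTorusGeometry

namespace Literature.MathematicalPhysics.QuantumFieldTheory.Dimock2011to13.ClusterExpansionWithHoles

open Literature.MathematicalPhysics.QuantumFieldTheory.Dimock2011to13.ThreeSorted
open Literature.MathematicalPhysics.QuantumFieldTheory.Dimock2011to13.HoleSummability
open Literature.MathematicalPhysics.QuantumFieldTheory.Dimock2011to13.HolePolymerKeyBounds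
open Literature.MathematicalPhysics.QuantumFieldTheory.Dimock2011to13.MayerExpansion
open Literature.MathematicalPhysics.QuantumFieldTheory.Balaban1983to89.B14.RelTreeLength (CAdj)
open Literature.Probability.LatticeModels
  (IsRConnected sum_pow_card_le_of_connected IsKPVolume kpTerm KPTouches touchSum touchSum_le_of_kp truncatedWeight
    truncatedWeight_eq_zero_of_kp IsPolymerCluster polymerPartitionFunction)

/-! ## Part 1. Graphs in the universal cover for ARBITRARY torus families (the classes of Ω-parts are non-empty) -/

section Graphs

variable {d N : ℕ}

/-- Every point of `ℝ^d` lies in a closed unit cube with integer corner, i.e. in `π⁻¹` of the whole torus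
(`liftCubes univ`). [folklore] -/
private theorem mem_liftCubes_univ [NeZero N] (p : RPt d) : p ∈ liftCubes (Finset.univ : Finset (TPt d N)) := by
  refine mem_liftCubes.2 ⟨fun i => ⌊p i⌋, Finset.mem_univ _, mem_cube.2 fun i => ⟨Int.floor_le _, ?_⟩⟩
  exact (Int.lt_floor_add_one (p i)).le

/-- The STAR GRAPH from a base point `p₀` to the points of a list (with the degenerate segment `[p₀, p₀]` in front, so
that the carrier always contains `p₀`). [folklore] -/
def starAt (p₀ : RPt d) (l : List (RPt d)) : List (Seg d) := ((p₀, p₀) : Seg d) :: l.map fun q => (p₀, q)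

/-- The base point lies on the star. [folklore] -/
private theorem base_mem_carrier_starAt (p₀ : RPt d) (l : List (RPt d)) : p₀ ∈ carrier (starAt p₀ l) := by
  rw [starAt, carrier_cons]
  exact Or.inl (left_mem_segment ℝ p₀ p₀)

/-- Every listed point lies on the star. [folklore] -/
private theorem mem_carrier_starAt {p₀ q : RPt d} {l : List (RPt d)} (hq : q ∈ l) : q ∈ carrier (starAt p₀ l) := by
  rw [mem_carrier]
  exact ⟨(p₀, q), List.mem_cons_of_mem _ (List.mem_map.2 ⟨q, hq, rfl⟩), right_mem_segment ℝ p₀ q⟩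

/-- The star is connected (a union of segments through the common point `p₀`). [folklore] -/
private theorem isConnected_carrier_starAt (p₀ : RPt d) : ∀ l : List (RPt d), IsConnected (carrier (starAt p₀ l))
  | [] => by
    simp only [starAt, List.map_nil, carrier_cons, carrier_nil, Set.union_empty, segment_same]
    exact isConnected_singleton
  | q :: l => by
    have ih := isConnected_carrier_starAt p₀ l
    have hbase := base_mem_carrier_starAt p₀ l
    have e : carrier (starAt p₀ (q :: l)) = segment ℝ p₀ q ∪ carrier (starAt p₀ l) := by
      simp only [starAt, List.map_cons, carrier_cons]
      rw [Set.union_left_comm]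
    rw [e]
    exact IsConnected.union ⟨p₀, left_mem_segment ℝ p₀ q, hbase⟩
      ((convex_segment p₀ q).isConnected ⟨p₀, left_mem_segment ℝ p₀ q⟩) ih

/-- **Every non-empty torus family has a graph in the universal cover meeting a lift of each of its cubes** (class
`TCover univ V` non-empty): the star through the corners of the standard lifts.  Needed because an Ω-part `Y ∩ Ω` of a
polymer with holes is in general NOT connected (L6930: *"Although X is connected, Y need not be"*), so the sibling's
`ThreeSorted.exists_tCover_of_dom` (face-connected families) does not apply. [cite: Dimock2013BalabanII, App. E Lemma E.3 proof (arXiv:1212.5562v2 TeX L6930)] -/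
theorem exists_tCover_univ [NeZero N] {V : Finset (TPt d N)} (hV : V.Nonempty) :
    ∃ T, TCover (Finset.univ : Finset (TPt d N)) V T := by
  obtain ⟨a₀, _⟩ := hV
  refine ⟨starAt (corner (natLift a₀)) (V.toList.map fun a => corner (natLift a)),
    isConnected_carrier_starAt _ _, fun p _ => mem_liftCubes_univ p, fun a ha => ?_⟩
  refine ⟨natLift a, proj_natLift a, corner (natLift a), ?_, corner_mem_cube _⟩
  exact mem_carrier_starAt (List.mem_map.2 ⟨a, Finset.mem_toList.2 ha, rfl⟩)

/-- Hence two Ω-meeting non-empty torus families stitch at cost one: `coverLen univ (A ∪ B) ≤ coverLen univ A +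
coverLen univ B + 1` (`HolePolymerKeyBounds.coverLen_union_le_of_common` with the classes supplied by
`exists_tCover_univ`) — the two-member case of (otter) for Ω-parts. [cite: Dimock2013BalabanII, App. F Theorem cluster3, proof eq. (otter) (arXiv:1212.5562v2 TeX L7037–7044)] -/
theorem coverLen_univ_union_le [NeZero N] {A B : Finset (TPt d N)} (hA : A.Nonempty) (hB : B.Nonempty)
    (h : ¬ Disjoint A B) :
    coverLen Finset.univ (A ∪ B) ≤ coverLen Finset.univ A + coverLen Finset.univ B + 1 := by
  obtain ⟨c, hcA, hcB⟩ := Finset.not_disjoint_iff.1 h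
  exact coverLen_union_le_of_common (exists_tCover_univ hA) (exists_tCover_univ hB) hcA hcB (Finset.mem_univ c)

end Graphs

/-! ## Part 2. (otter) for Ω-parts: subadditivity of `coverLen univ` over intersect-connected families -/

section Otter

variable {d N : ℕ} [NeZero N]

/-- THE STITCHING INDUCTION for Ω-parts (L7041–7044 *"Stitch together the τ_i to get a graph τ on the cubes in ∪_i (X_i
∩ Ω) = Y ∩ Ω with ℓ(τ) ≤ Σ_i ℓ(τ_i) + M(n−1)"*), for a family `𝒞` of non-empty torus families which is a cluster for
Dimock's hard core `MayerExpansion.Inc` ("intersect"): growing a sub-family `G` one intersecting member at a time, the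
bound `coverLen univ (∪G) ≤ Σ_{V∈G} coverLen univ V + (|G| − 1)` propagates to `𝒞`. [cite: Dimock2013BalabanII, App. F Theorem cluster3, proof eq. (otter) (arXiv:1212.5562v2 TeX L7037–7044)] -/
theorem cluster_induction {𝒞 : Finset (Finset (TPt d N))} (hne : ∀ V ∈ 𝒞, V.Nonempty)
    (hcl : IsPolymerCluster Inc 𝒞) :
    ∀ n : ℕ, ∀ G : Finset (Finset (TPt d N)), G ⊆ 𝒞 → G.Nonempty → (𝒞 \ G).card = n →
      coverLen Finset.univ (G.biUnion id) ≤ ∑ V ∈ G, coverLen Finset.univ V + ((G.card : ℝ) - 1) →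
      coverLen Finset.univ (𝒞.biUnion id) ≤ ∑ V ∈ 𝒞, coverLen Finset.univ V + ((𝒞.card : ℝ) - 1) := by
  classical
  intro n
  induction n with
  | zero =>
    intro G hG𝒞 _ hcard hG
    have hGeq : G = 𝒞 :=
      Finset.Subset.antisymm hG𝒞 (Finset.sdiff_eq_empty_iff_subset.1 (Finset.card_eq_zero.1 hcard))
    subst hGeq
    exact hG
  | succ n ih =>
    intro G hG𝒞 hGne hcard hG
    have hdiff : (𝒞 \ G).Nonempty := by
      rw [← Finset.card_pos, hcard]
      exact Nat.succ_pos n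
    obtain ⟨V₁, hV₁G, V₂, hV₂, hInc⟩ := hcl G hG𝒞 hGne hdiff
    obtain ⟨hV₂𝒞, hV₂G⟩ := Finset.mem_sdiff.1 hV₂
    have hnd : ¬ Disjoint V₁ V₂ := by
      rcases hInc with h | h
      · exact h
      · exact absurd hV₁G (h ▸ hV₂G)
    obtain ⟨c, hcV₁, hcV₂⟩ := Finset.not_disjoint_iff.1 hnd
    have hcU : c ∈ G.biUnion id := Finset.mem_biUnion.2 ⟨V₁, hV₁G, hcV₁⟩
    have hUne : (G.biUnion id).Nonempty := ⟨c, hcU⟩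
    have hle' : coverLen Finset.univ (V₂ ∪ G.biUnion id) ≤
        coverLen Finset.univ V₂ + coverLen Finset.univ (G.biUnion id) + 1 :=
      coverLen_union_le_of_common (exists_tCover_univ (hne V₂ hV₂𝒞)) (exists_tCover_univ hUne) hcV₂ hcU
        (Finset.mem_univ c)
    have hsub : insert V₂ G ⊆ 𝒞 := Finset.insert_subset hV₂𝒞 hG𝒞
    have hcard' : (𝒞 \ insert V₂ G).card = n := by
      rw [Finset.sdiff_insert, Finset.card_erase_of_mem (Finset.mem_sdiff.2 ⟨hV₂𝒞, hV₂G⟩), hcard]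
      simp
    refine ih (insert V₂ G) hsub (Finset.insert_nonempty _ _) hcard' ?_
    rw [Finset.biUnion_insert, Finset.sum_insert hV₂G, Finset.card_insert_of_notMem hV₂G]
    change coverLen Finset.univ (V₂ ∪ G.biUnion id) ≤ _
    push_cast
    linarith

/-- **(otter) FOR Ω-PARTS**: for a non-empty finite family `𝒞` of non-empty torus families which *"cannot be divided into
Ω-disjoint sets"* (a cluster for the hard core "intersect", `LatticeModels.IsPolymerCluster MayerExpansion.Inc`),
`coverLen univ (∪𝒞) ≤ Σ_{V∈𝒞} coverLen univ V + (|𝒞| − 1)` (`M = 1`). [cite: Dimock2013BalabanII, App. F Theorem cluster3, proof eq. (otter) (arXiv:1212.5562v2 TeX L7037–7044)] -/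
theorem coverLen_biUnion_le_of_isPolymerCluster {𝒞 : Finset (Finset (TPt d N))} (h𝒞 : 𝒞.Nonempty)
    (hne : ∀ V ∈ 𝒞, V.Nonempty) (hcl : IsPolymerCluster Inc 𝒞) :
    coverLen Finset.univ (𝒞.biUnion id) ≤ ∑ V ∈ 𝒞, coverLen Finset.univ V + ((𝒞.card : ℝ) - 1) := by
  classical
  obtain ⟨V₁, hV₁⟩ := h𝒞
  refine cluster_induction hne hcl _ {V₁} (Finset.singleton_subset_iff.2 hV₁) (Finset.singleton_nonempty _) rfl ?_
  simp

/-- The decay-bookkeeping form of (otter) for Ω-parts: with `d(V) = δ(coverLen univ V + 1)`, `δ ≥ 0`, a cluster `𝒞` with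
union `V` has `d(V) ≤ Σ_{V′∈𝒞} d(V′)` (the `+1` per member pays for the stitching segments). [cite: Dimock2013BalabanII, App. F Theorem cluster3, proof eq. (otter) (arXiv:1212.5562v2 TeX L7037–7044)] -/
theorem decay_union_le_sum {𝒞 : Finset (Finset (TPt d N))} (h𝒞 : 𝒞.Nonempty) (hne : ∀ V ∈ 𝒞, V.Nonempty)
    (hcl : IsPolymerCluster Inc 𝒞) {δ : ℝ} (hδ : 0 ≤ δ) :
    δ * (coverLen Finset.univ (𝒞.biUnion id) + 1) ≤ ∑ V ∈ 𝒞, δ * (coverLen Finset.univ V + 1) := by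
  have h := coverLen_biUnion_le_of_isPolymerCluster h𝒞 hne hcl
  rw [← Finset.mul_sum, Finset.sum_add_distrib, Finset.sum_const, nsmul_eq_mul, mul_one]
  exact mul_le_mul_of_nonneg_left (by linarith) hδ

end Otter

/-! ## Part 3. Lemma E.2-type summability over ARBITRARY (disconnected) torus families through a cube -/

section Summability

variable {d N : ℕ} [NeZero N]

/-- THE ANIMAL OF AN Ω-PART: for a torus family `V ∋ c` and `ε > 0` there is a corner-connected finite `A ⊂ ℤ^d`
containing the standard lift `natLift c`, with `V ⊆ π(A)` and `#A ≤ 2^d(4(coverLen univ V + ε) + 1)` — the met family of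
a near-optimal graph of the class `(univ, V)` re-sheeted through the cube `natLift c` (`HoleSummability.animal`, App. E
Lemma E.1 (3)'s mechanism). [cite: Dimock2013BalabanII, App. E Lemma E.1(3), Lemma E.2 (arXiv:1212.5562v2 TeX L6790–6912)] -/
theorem exists_animal_univ {V : Finset (TPt d N)} {c : TPt d N} (hcV : c ∈ V) {ε : ℝ} (hε : 0 < ε) :
    ∃ A : Finset (Pt d), natLift c ∈ A ∧ IsRConnected CAdj A ∧ V ⊆ A.image (proj N) ∧
      (A.card : ℝ) ≤ 2 ^ d * (4 * (coverLen Finset.univ V + ε) + 1) := by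
  have hne : ∃ T, TCover Finset.univ V T := exists_tCover_univ ⟨c, hcV⟩
  obtain ⟨T, hT, hlt⟩ := exists_tCover_len_lt hne hε
  obtain ⟨T', hT', hlen, hmeet⟩ := TCover.exists_translate_meets hT hcV (proj_natLift c)
  refine ⟨animal Finset.univ T', mem_animal_of_meets hT' (Finset.mem_univ _) hmeet, isRConnected_animal hT',
    subset_image_animal hT' (Finset.subset_univ _), ?_⟩
  have h1 := card_animal_le hT'
  have h2 : len T' ≤ coverLen Finset.univ V + ε := by rw [hlen]; exact hlt.le
  have h3 : (2 : ℝ) ^ d * (4 * len T' + 1) ≤ 2 ^ d * (4 * (coverLen Finset.univ V + ε) + 1) := by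
    have : (0 : ℝ) ≤ 2 ^ d := by positivity
    nlinarith
  exact h1.trans h3

/-- **LEMMA E.2-TYPE SUMMABILITY ON THE TORUS, DISCONNECTED FAMILIES** — the rôle of [Dimock2013BalabanII] App. E LEMMA
E.2 `\label{kumquat}` (L6833–6838: *"for a = 𝒪(1) sufficiently large there are constants b′ = 𝒪(1) such that for any
M-cube □: Σ_{Y ∋ □} e^{−a′ℓ′_M(Y)} ≤ b′"*, the sum over ALL finite unions `Y` of `M`-cubes, connected or not) for the
torus Steiner length `coverLen univ`: for any cube `c`, any finite family `𝒱` of torus families through `c` and `κ ≥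
κ₁(d)`, `Σ_{V∈𝒱} e^{−κ·coverLen univ V} ≤ K₁(d)`.  Proof = the sibling's (sumsum) route (`HoleSummability.
sum_exp_torusTreeLenMod_le`): regroup by the animal of Part-3's `exists_animal_univ` (ε = ¼), fibre of an animal `A` ⊆
the subsets of `π(A)` (≤ `2^{#A}` ≤ `2^{#A}·2^{2d·#A}` members), connected-animal count with the smallness at `κ₁(d)`.
[cite: Dimock2013BalabanII, App. E Lemma E.2 (arXiv:1212.5562v2 TeX L6833–6912)] -/
theorem sum_exp_coverLen_le (c : TPt d N) (𝒱 : Finset (Finset (TPt d N))) (h𝒱 : ∀ V ∈ 𝒱, c ∈ V) {κ : ℝ}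
    (hκ : kappa₁ d ≤ κ) :
    ∑ V ∈ 𝒱, Real.exp (-κ * coverLen Finset.univ V) ≤ K₁ d := by
  classical
  set κ₁ := kappa₁ d with hκ₁
  set μ : ℝ := Real.exp (-(κ₁ / 2 ^ (d + 2))) with hμ
  have hμ0 : 0 ≤ μ := (Real.exp_pos _).le
  -- Step 0: monotonicity in κ
  have step0 : ∑ V ∈ 𝒱, Real.exp (-κ * coverLen Finset.univ V) ≤
      ∑ V ∈ 𝒱, Real.exp (-κ₁ * coverLen Finset.univ V) := by
    refine Finset.sum_le_sum fun V _ => Real.exp_le_exp.2 ?_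
    have := coverLen_nonneg (Finset.univ : Finset (TPt d N)) V
    nlinarith
  refine step0.trans ?_
  -- Step 1: animals
  have hA : ∀ V ∈ 𝒱, ∃ A : Finset (Pt d), natLift c ∈ A ∧ IsRConnected CAdj A ∧ V ⊆ A.image (proj N) ∧
      (A.card : ℝ) ≤ 2 ^ d * (4 * (coverLen Finset.univ V + 1 / 4) + 1) := fun V hV =>
    exists_animal_univ (h𝒱 V hV) (by norm_num)
  choose! anim hc1 hc2 hc3 hc5 using hA
  -- Step 2: termwise bound exp(−κ₁ ℓ) ≤ e^{κ₁/2} μ^{#A}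
  have hterm : ∀ V ∈ 𝒱, Real.exp (-κ₁ * coverLen Finset.univ V) ≤ Real.exp (κ₁ / 2) * μ ^ (anim V).card := by
    intro V hV
    have h5 := hc5 V hV
    have hk0 : 0 ≤ κ₁ := kappa₁_nonneg d
    have hpow : μ ^ (anim V).card = Real.exp (-(κ₁ / 2 ^ (d + 2)) * (anim V).card) := by
      rw [hμ, ← Real.exp_nat_mul]; ring_nf
    rw [hpow, ← Real.exp_add, Real.exp_le_exp]
    have h2d : (0 : ℝ) < 2 ^ (d + 2) := by positivity
    have h6 : ((anim V).card : ℝ) ≤ 2 ^ (d + 2) * coverLen Finset.univ V + 2 ^ (d + 2) / 2 := by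
      have : (2 : ℝ) ^ d * (4 * (coverLen Finset.univ V + 1 / 4) + 1)
          = 2 ^ (d + 2) * coverLen Finset.univ V + 2 ^ (d + 2) / 2 := by ring
      linarith
    have h7 : κ₁ / 2 ^ (d + 2) * ((anim V).card : ℝ) ≤ κ₁ * coverLen Finset.univ V + κ₁ / 2 := by
      have := mul_le_mul_of_nonneg_left h6 (div_nonneg hk0 h2d.le)
      have e : κ₁ / 2 ^ (d + 2) * (2 ^ (d + 2) * coverLen Finset.univ V + 2 ^ (d + 2) / 2)
          = κ₁ * coverLen Finset.univ V + κ₁ / 2 := by field_simp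
      linarith
    linarith
  -- Step 3: regroup by the animal
  set 𝒜 := 𝒱.image anim with h𝒜
  have hfib : ∑ V ∈ 𝒱, μ ^ (anim V).card
      = ∑ A ∈ 𝒜, ((𝒱.filter (fun V => anim V = A)).card : ℝ) * μ ^ A.card := by
    rw [← Finset.sum_fiberwise_of_maps_to (s := 𝒱) (t := 𝒜) (g := anim)
      (fun V hV => Finset.mem_image_of_mem _ hV)]
    refine Finset.sum_congr rfl fun A _ => ?_
    rw [Finset.sum_congr rfl (fun V hV => by rw [(Finset.mem_filter.1 hV).2]), Finset.sum_const, nsmul_eq_mul]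
  -- Step 4: the fibre count ≤ 2^{#π(A)} ≤ 2^{(2d+1)#A} (the fibre of `A` consists of subsets of `π(A)`)
  have hcount : ∀ A ∈ 𝒜, ((𝒱.filter (fun V => anim V = A)).card : ℝ) * μ ^ A.card
      ≤ (2 ^ (2 * d + 1) * μ) ^ A.card := by
    intro A _
    set P := A.image (proj N) with hP
    have hPc : P.card ≤ A.card := Finset.card_image_le
    have hFP : 𝒱.filter (fun V => anim V = A) ⊆ P.powerset := by
      intro V hV
      obtain ⟨hV𝒱, hVA⟩ := Finset.mem_filter.1 hV
      rw [Finset.mem_powerset, hP, ← hVA]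
      exact hc3 V hV𝒱
    have hnat : (𝒱.filter (fun V => anim V = A)).card ≤ 2 ^ P.card := by
      rw [← Finset.card_powerset]
      exact Finset.card_le_card hFP
    have hreal : ((𝒱.filter (fun V => anim V = A)).card : ℝ) ≤ (2 : ℝ) ^ A.card * 2 ^ (2 * d * A.card) := by
      have h1 : ((𝒱.filter (fun V => anim V = A)).card : ℝ) ≤ (2 : ℝ) ^ P.card := by exact_mod_cast hnat
      have h2 : (2 : ℝ) ^ P.card ≤ 2 ^ A.card := pow_le_pow_right₀ (by norm_num) hPc
      have h3 : (1 : ℝ) ≤ 2 ^ (2 * d * A.card) := one_le_pow₀ (by norm_num)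
      calc _ ≤ (2 : ℝ) ^ A.card := h1.trans h2
        _ ≤ 2 ^ A.card * 2 ^ (2 * d * A.card) := le_mul_of_one_le_right (by positivity) h3
    calc ((𝒱.filter (fun V => anim V = A)).card : ℝ) * μ ^ A.card
        ≤ ((2 : ℝ) ^ A.card * 2 ^ (2 * d * A.card)) * μ ^ A.card :=
          mul_le_mul_of_nonneg_right hreal (pow_nonneg hμ0 _)
      _ = (2 ^ (2 * d + 1) * μ) ^ A.card := by
          rw [mul_pow, ← pow_mul, ← pow_add]
          congr 1
          ring
  -- Step 5: the lattice-animal bound in ℤ^d (corner adjacency, neighbourhoods = the 3^d blocks)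
  have h𝒜conn : ∀ A ∈ 𝒜, natLift c ∈ A ∧ IsRConnected CAdj A := by
    intro A hA
    obtain ⟨V, hV, rfl⟩ := Finset.mem_image.1 hA
    exact ⟨hc1 V hV, hc2 V hV⟩
  have hν0 : 0 ≤ 2 ^ (2 * d + 1) * μ := by positivity
  have hsmall : (((3 ^ d : ℕ) : ℝ) + 1) ^ 2 * (2 ^ (2 * d + 1) * μ) ≤ 1 / 2 := smallness_kappa₁ d
  have hanimal : ∑ A ∈ 𝒜, (2 ^ (2 * d + 1) * μ) ^ A.card ≤ 2 * (2 ^ (2 * d + 1) * μ) :=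
    sum_pow_card_le_of_connected (R := CAdj) (nbr := B13ScaleTransfer.block) (Δ := 3 ^ d)
      (fun _ _ h => h.symm) (fun x => (B13ScaleTransfer.card_block x).le) (fun _ _ h => h.2) hν0 hsmall
      (natLift c) 𝒜 h𝒜conn
  -- Step 6: assemble
  have hK : Real.exp (κ₁ / 2) * (2 * (2 ^ (2 * d + 1) * μ)) = K₁ d := by
    have hM : (0 : ℝ) < 2 ^ (2 * d + 2) * ((3 : ℝ) ^ d + 1) ^ 2 := by positivity
    have hexp : μ = (2 ^ (2 * d + 2) * ((3 : ℝ) ^ d + 1) ^ 2)⁻¹ := by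
      have h2 : (2 : ℝ) ^ (d + 2) ≠ 0 := by positivity
      rw [hμ, hκ₁, kappa₁, mul_div_cancel_left₀ _ h2, Real.exp_neg, Real.exp_log hM]
    rw [hexp, K₁, hκ₁]
    have h3 : ((3 : ℝ) ^ d + 1) ^ 2 ≠ 0 := by positivity
    field_simp
    ring
  calc ∑ V ∈ 𝒱, Real.exp (-κ₁ * coverLen Finset.univ V)
      ≤ ∑ V ∈ 𝒱, Real.exp (κ₁ / 2) * μ ^ (anim V).card := Finset.sum_le_sum hterm
    _ = Real.exp (κ₁ / 2) * ∑ V ∈ 𝒱, μ ^ (anim V).card := by rw [Finset.mul_sum]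
    _ = Real.exp (κ₁ / 2) * ∑ A ∈ 𝒜, ((𝒱.filter (fun V => anim V = A)).card : ℝ) * μ ^ A.card := by rw [hfib]
    _ ≤ Real.exp (κ₁ / 2) * ∑ A ∈ 𝒜, (2 ^ (2 * d + 1) * μ) ^ A.card :=
        mul_le_mul_of_nonneg_left (Finset.sum_le_sum hcount) (Real.exp_pos _).le
    _ ≤ Real.exp (κ₁ / 2) * (2 * (2 ^ (2 * d + 1) * μ)) :=
        mul_le_mul_of_nonneg_left hanimal (Real.exp_pos _).le
    _ = K₁ d := hK

/-- The (keykey1)-shape for Ω-parts: for any finite family `𝒱` of torus families and any torus family `V`, `Σ_{V′ ∈ 𝒱, V′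
∩ V ≠ ∅} e^{−κ·coverLen univ V′} ≤ K₁(d)·|V|` (`κ ≥ κ₁(d)`) — every such `V′` contains a cube of `V`, so the sum is at most
`Σ_{□ ∈ V} Σ_{V′ ∋ □}`. [cite: Dimock2013BalabanII, App. F Theorem cluster3, proof eq. (keykey1) (arXiv:1212.5562v2 TeX L7007–7011)] -/
theorem sum_exp_coverLen_inter_le (V : Finset (TPt d N)) (𝒱 : Finset (Finset (TPt d N))) {κ : ℝ}
    (hκ : kappa₁ d ≤ κ) :
    ∑ V' ∈ 𝒱 with ¬ Disjoint V' V, Real.exp (-κ * coverLen Finset.univ V') ≤ K₁ d * (V.card : ℝ) := by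
  classical
  set P := 𝒱.filter fun V' => ¬ Disjoint V' V with hP
  set Q : TPt d N → Finset (Finset (TPt d N)) := fun c => 𝒱.filter fun V' => c ∈ V' with hQ
  have hcov : ∀ V' ∈ P, ∃ c ∈ V, V' ∈ Q c := by
    intro V' hV'
    rw [hP, Finset.mem_filter] at hV'
    obtain ⟨hV'𝒱, hnd⟩ := hV'
    obtain ⟨c, hcV', hcV⟩ := Finset.not_disjoint_iff.1 hnd
    exact ⟨c, hcV, Finset.mem_filter.2 ⟨hV'𝒱, hcV'⟩⟩
  have h1 := sum_le_sum_sum_of_cover P V Q (fun V' => Real.exp (-κ * coverLen Finset.univ V'))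
    (fun V' => (Real.exp_pos _).le) hcov
  have h2 : ∀ c ∈ V, ∑ V' ∈ Q c, Real.exp (-κ * coverLen Finset.univ V') ≤ K₁ d := by
    intro c _
    exact sum_exp_coverLen_le c (Q c) (fun V' hV' => (Finset.mem_filter.1 hV').2) hκ
  calc ∑ V' ∈ P, Real.exp (-κ * coverLen Finset.univ V')
      ≤ ∑ c ∈ V, ∑ V' ∈ Q c, Real.exp (-κ * coverLen Finset.univ V') := h1
    _ ≤ ∑ c ∈ V, K₁ d := Finset.sum_le_sum h2
    _ = K₁ d * (V.card : ℝ) := by rw [Finset.sum_const, nsmul_eq_mul, mul_comm]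

end Summability

/-! ## Part 4. The App. B kernel with supports prescribed on `Pol` only (congruence in the support map) -/

section Congr

variable {P C : Type*} [DecidableEq C]

/-- Chains for one overlap relation are chains for any relation agreeing with it on the collection. [folklore] -/
private theorem linked_of_linked {ov ov' : P → P → Prop} {S : Finset P} (h : ∀ X ∈ S, ∀ Y ∈ S, ov X Y → ov' X Y) {X Y : P}
    (hL : Linked ov S X Y) : Linked ov' S X Y := by
  induction hL with
  | refl => exact Relation.ReflTransGen.refl
  | tail _ hbc ih => exact ih.tail ⟨hbc.1, hbc.2.1, h _ hbc.1 _ hbc.2.1 hbc.2.2⟩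

/-- Connectedness of a collection only depends on the overlap relation restricted to the collection. [folklore] -/
private theorem isConnColl_congr {ov ov' : P → P → Prop} {S : Finset P} (h : ∀ X ∈ S, ∀ Y ∈ S, (ov X Y ↔ ov' X Y)) :
    IsConnColl ov S ↔ IsConnColl ov' S := by
  constructor
  · rintro ⟨hne, hL⟩
    exact ⟨hne, fun X hX Y hY => linked_of_linked (fun A hA B hB => (h A hA B hB).1) (hL X hX Y hY)⟩
  · rintro ⟨hne, hL⟩
    exact ⟨hne, fun X hX Y hY => linked_of_linked (fun A hA B hB => (h A hA B hB).2) (hL X hX Y hY)⟩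

/-- Support maps agreeing on a sub-collection give the same union. [folklore] -/
private theorem U_congr {supp supp' : P → Finset C} {T : Finset P} (h : ∀ X ∈ T, supp X = supp' X) :
    U supp T = U supp' T :=
  Finset.biUnion_congr rfl h

/-- Support maps agreeing on a sub-collection give the same overlaps inside it. [folklore] -/
private theorem overlap_congr {supp supp' : P → Finset C} {T : Finset P} (h : ∀ X ∈ T, supp X = supp' X) :
    ∀ X ∈ T, ∀ Y ∈ T, (MayerExpansion.Overlap supp X Y ↔ MayerExpansion.Overlap supp' X Y) := by
  intro X hX Y hY
  unfold MayerExpansion.Overlap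
  rw [h X hX, h Y hY]

/-- **The connected covers of the App. B kernel only see the supports of the members of `Pol`.** [cite: Dimock2013, App. B Theorem cluster, proof step 1 (arXiv:1108.1335v2 TeX L3204–3225)] -/
theorem covers_congr {supp supp' : P → Finset C} {Pol : Finset P} (h : ∀ X ∈ Pol, supp X = supp' X) (Y : Finset C) :
    covers supp Pol Y = covers supp' Pol Y := by
  ext T
  rw [mem_covers, mem_covers]
  constructor
  · rintro ⟨hT, hc, hU⟩
    have h' : ∀ X ∈ T, supp X = supp' X := fun X hX => h X (hT hX)
    exact ⟨hT, (isConnColl_congr (overlap_congr h')).1 hc, (U_congr h').symm.trans hU⟩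
  · rintro ⟨hT, hc, hU⟩
    have h' : ∀ X ∈ T, supp' X = supp X := fun X hX => (h X (hT hX)).symm
    exact ⟨hT, (isConnColl_congr (overlap_congr h')).1 hc, (U_congr h').symm.trans hU⟩

/-- Hence Dimock's `K(Y)` only sees the supports of the members of `Pol`. [cite: Dimock2013, App. B Theorem cluster, proof step 1 (arXiv:1108.1335v2 TeX L3215–3219)] -/
theorem K_congr {R : Type*} [AddCommMonoid R] {supp supp' : P → Finset C} {Pol : Finset P}
    (h : ∀ X ∈ Pol, supp X = supp' X) (g : Finset P → R) : K supp Pol g = K supp' Pol g := by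
  funext Y
  unfold K
  rw [covers_congr h]

/-- The polymers of the regrouped gas only see the supports of the members of `Pol`. [cite: Dimock2013, App. B Theorem cluster, proof step 1 (arXiv:1108.1335v2 TeX L3204–3225)] -/
theorem unions_congr {supp supp' : P → Finset C} {Pol : Finset P} (h : ∀ X ∈ Pol, supp X = supp' X) :
    unions supp Pol = unions supp' Pol := by
  unfold unions
  congr 1
  refine Finset.image_congr fun T hT => ?_
  exact U_congr fun X hX => h X (Finset.mem_powerset.1 (Finset.mem_coe.1 hT) hX)

/-- `H^#` only sees the supports of the members of `Pol`. [cite: Dimock2013, App. B Theorem cluster, proof step 3 eq. (hstar) (arXiv:1108.1335v2 TeX L3305–3315)] -/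
theorem Hsharp_congr {supp supp' : P → Finset C} {Pol : Finset P} (h : ∀ X ∈ Pol, supp X = supp' X) :
    Hsharp supp Pol = Hsharp supp' Pol := by
  funext w Y
  unfold Hsharp
  rw [unions_congr h]

/-- **STEPS 1–3 OF THE APP. B KERNEL WITH SUPPORTS NON-EMPTY ON `Pol` ONLY**: `MayerExpansion.cexp_sum_eq_cexp_sum_Hsharp`
asks `∀ X, (supp X).Nonempty`; modifying `supp` off `Pol` to a fixed one-cube support (any cube `c`) changes none of
`K`, `unions`, `H^#`, so the identity `exp(Σ_{X∈Pol} H(X)) = exp(Σ_Y H^#(Y))` holds under `∀ X ∈ Pol, (supp X).Nonempty`.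
[cite: Dimock2013, App. B Theorem cluster (arXiv:1108.1335v2 TeX L3178–3194, proof L3204–3394)] -/
theorem cexp_sum_eq_cexp_sum_Hsharp_of_pol (c : C) {supp : P → Finset C} {Pol : Finset P}
    (hsupp : ∀ X ∈ Pol, (supp X).Nonempty) (H : P → ℂ) {a : Finset C → ℝ}
    (hKP : IsKPVolume Inc (K supp Pol fun T => ∏ X ∈ T, (Complex.exp (H X) - 1)) a (unions supp Pol)) :
    Complex.exp (∑ X ∈ Pol, H X) =
      Complex.exp (∑ Y ∈ (unions supp Pol).powerset.image (fun 𝒞 => 𝒞.biUnion id),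
        Hsharp supp Pol (K supp Pol fun T => ∏ X ∈ T, (Complex.exp (H X) - 1)) Y) := by
  classical
  let supp' : P → Finset C := fun X => if X ∈ Pol then supp X else {c}
  have h : ∀ X ∈ Pol, supp' X = supp X := fun X hX => by simp [supp', hX]
  have hne : ∀ X, (supp' X).Nonempty := fun X => by
    by_cases hX : X ∈ Pol
    · rw [h X hX]; exact hsupp X hX
    · simp [supp', hX]
  have hKP' : IsKPVolume Inc (K supp' Pol fun T => ∏ X ∈ T, (Complex.exp (H X) - 1)) a (unions supp' Pol) := by
    rw [K_congr h, unions_congr h]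
    exact hKP
  have e1 := cexp_sum_eq_cexp_sum_Hsharp hne H hKP'
  rw [K_congr h, unions_congr h, Hsharp_congr h] at e1
  exact e1

end Congr

/-! ## Part 5. The Kotecký–Preiss condition of the hard-core gas of Ω-parts -/

section KP

variable {d N : ℕ} [NeZero N]

/-- The decay rate left for `H^#` after the three losses of the Kotecký–Preiss bookkeeping (the `κ₀ + 2` of (simplon),
the `4·2^d` of (keykey2) = `ninety_of_keykey2` feeding `e^{a(V)}`, the `κ₁(d)` of Part 3's summability): `δ(κ) := κ − κ₀ − 2
− 4·2^d − κ₁(d)`. [cite: Dimock2013BalabanII, App. F Theorem cluster3 (arXiv:1212.5562v2 TeX L6984–6997)] -/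
def delta (d : ℕ) (κ κ₀ : ℝ) : ℝ := κ - κ₀ - 2 - 4 * 2 ^ d - kappa₁ d

/-- The Kotecký–Preiss size constant `θ := 2e·K₁(d)²·κ₀·e^{4·2^d + δ}·H₀` (`a(V) = θ|V|`). [cite: Dimock2013BalabanII, App. F Theorem cluster3 (arXiv:1212.5562v2 TeX L6984–6997)] -/
def theta (d : ℕ) (κ κ₀ H₀ : ℝ) : ℝ :=
  2 * Real.exp 1 * K₁ d ^ 2 * κ₀ * Real.exp (4 * 2 ^ d + delta d κ κ₀) * H₀

/-- The constant `𝒪(1)` of (sunshine) in this module: `C♯(d, κ₀) := 8e·2^d·K₁(d)²·κ₀·e^{4·2^d}` (dimension and `κ₀` only).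
[cite: Dimock2013BalabanII, App. F Theorem cluster3 eq. (sunshine) (arXiv:1212.5562v2 TeX L6994–6996)] -/
def Csharp (d : ℕ) (κ₀ : ℝ) : ℝ := 8 * Real.exp 1 * 2 ^ d * K₁ d ^ 2 * κ₀ * Real.exp (4 * 2 ^ d)

/-- The Kotecký–Preiss size function of an Ω-part: `a(V) = θ·|V|`. [cite: KoteckyPreiss1986, (1)] -/
def kpSize (θ : ℝ) (V : Finset (TPt d N)) : ℝ := θ * (V.card : ℝ)

/-- The Kotecký–Preiss decay function of an Ω-part: `d(V) = δ·(coverLen univ V + 1)`. [cite: KoteckyPreiss1986, (1)] -/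
def kpDecay (δ : ℝ) (V : Finset (TPt d N)) : ℝ := δ * (coverLen Finset.univ V + 1)

omit [NeZero N] in
/-- Members of `unions` are non-empty. [folklore] -/
private theorem nonempty_of_mem_unions {supp : Finset (TPt d N) → Finset (TPt d N)} {Pol : Finset (Finset (TPt d N))}
    {V : Finset (TPt d N)} (hV : V ∈ unions supp Pol) : V.Nonempty :=
  (Finset.mem_filter.1 hV).2

/-- `0 ≤ θ` for `H₀ ≥ 0`, `κ₀ ≥ 0`. [folklore] -/
private theorem theta_nonneg {κ κ₀ H₀ : ℝ} (hκ₀ : 0 ≤ κ₀) (hH₀ : 0 ≤ H₀) : 0 ≤ theta d κ κ₀ H₀ := by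
  unfold theta
  have := K₁_pos d
  positivity

omit [NeZero N] in
/-- The activity bound on `Pol` from the field bound on `Pol`: `‖H(X)‖ ≤ H₀e^{−κ d_M(X, mod Θ)}`, `0 ≤ H₀ ≤ log 2`, `κ ≥ 0`
give `‖e^{H(X)} − 1‖ ≤ 2H₀e^{−κ d_M(X, mod Θ)}` (part I L3234–3236 *"If H_0 ≤ log 2 then … |e^{H(X,Φ)} − 1| ≤ 2H(X,Φ)"*; the
sibling's `ClusterActivityBound.weight_le` asks the field bound for every `X`, here only on `Pol`). [cite: Dimock2013, App. B Theorem cluster, proof step 1 (arXiv:1108.1335v2 TeX L3234–3237)] -/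
theorem weight_le_of_mem (Θ : Finset (TPt d N)) {Pol : Finset (Finset (TPt d N))} {H : Finset (TPt d N) → ℂ}
    {H₀ κ : ℝ} (hH₀ : 0 ≤ H₀) (hlog : H₀ ≤ Real.log 2) (hκ : 0 ≤ κ)
    (hH : ∀ X ∈ Pol, ‖H X‖ ≤ H₀ * Real.exp (-κ * torusTreeLenMod X Θ)) :
    ∀ X ∈ Pol, ‖Complex.exp (H X) - 1‖ ≤ 2 * H₀ * Real.exp (-κ * torusTreeLenMod X Θ) := by
  intro X hX
  have hexp : Real.exp (-κ * torusTreeLenMod X Θ) ≤ 1 := by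
    rw [Real.exp_le_one_iff]
    nlinarith [torusTreeLenMod_nonneg X Θ]
  have h1 : ‖H X‖ ≤ Real.log 2 := (hH X hX).trans ((mul_le_of_le_one_right hH₀ hexp).trans hlog)
  calc ‖Complex.exp (H X) - 1‖ ≤ 2 * ‖H X‖ := ClusterActivityBound.norm_exp_sub_one_le_two_mul h1
    _ ≤ 2 * (H₀ * Real.exp (-κ * torusTreeLenMod X Θ)) := by linarith [hH X hX]
    _ = 2 * H₀ * Real.exp (-κ * torusTreeLenMod X Θ) := by ring

/-- `1 ≤ K₁(d)` for the explicit constant `K₁(d) = e^{κ₁(d)/2}/(3^d+1)²` of the sibling's (sumsum) (print: *"K_0 = 𝒪(1)"*; indeed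
`K₁(d) ≥ 2^{2d+2}`). [cite: Dimock2013BalabanII, App. E Lemma E.3 (arXiv:1212.5562v2 TeX L6914–6920)] -/
theorem one_le_K₁ (d : ℕ) : 1 ≤ K₁ d := by
  have h3 : (0 : ℝ) < ((3 : ℝ) ^ d + 1) ^ 2 := by positivity
  have hM1 : (1 : ℝ) ≤ 2 ^ (2 * d + 2) * ((3 : ℝ) ^ d + 1) ^ 2 := by
    have h1 : (1 : ℝ) ≤ 2 ^ (2 * d + 2) := one_le_pow₀ (by norm_num)
    have h2 : (1 : ℝ) ≤ ((3 : ℝ) ^ d + 1) ^ 2 := by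
      have : (1 : ℝ) ≤ (3 : ℝ) ^ d + 1 := by
        have : (0 : ℝ) ≤ (3 : ℝ) ^ d := by positivity
        linarith
      nlinarith
    nlinarith
  have hlog : 0 ≤ Real.log (2 ^ (2 * d + 2) * ((3 : ℝ) ^ d + 1) ^ 2) := Real.log_nonneg hM1
  rw [K₁, le_div_iff₀ h3, one_mul]
  calc ((3 : ℝ) ^ d + 1) ^ 2 ≤ 2 ^ (2 * d + 2) * ((3 : ℝ) ^ d + 1) ^ 2 :=
        le_mul_of_one_le_left h3.le (one_le_pow₀ (by norm_num))
    _ = Real.exp (Real.log (2 ^ (2 * d + 2) * ((3 : ℝ) ^ d + 1) ^ 2)) := (Real.exp_log (by positivity)).symm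
    _ ≤ Real.exp (kappa₁ d / 2) := by
        rw [Real.exp_le_exp, kappa₁]
        have h2 : (2 : ℝ) ≤ 2 ^ (d + 2) := by
          calc (2 : ℝ) = 2 ^ 1 := (pow_one _).symm
            _ ≤ 2 ^ (d + 2) := pow_le_pow_right₀ (by norm_num) (by omega)
        rw [le_div_iff₀ (by norm_num : (0 : ℝ) < 2)]
        nlinarith [mul_le_mul_of_nonneg_right h2 hlog]

/-- The two working smallness conditions from the single one `2e·K₁(d)²·κ₀·e^{κ}·H₀ ≤ 1` (with `κ₀ ≥ 0`, `H₀ ≥ 0`): the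
(simplon)-smallness `2H₀K₁(d)κ₀e^{κ−κ₀} ≤ 1` (part I App. B step 1, L3272–3273: *"we assume c_0 is small enough so that
2c_0K_0κ_0e^{κ−κ_0} ≤ 1. (So c_0 does depend on κ.)"*) and `θ ≤ 1`. [cite: Dimock2013, App. B Theorem cluster, proof step 1 (arXiv:1108.1335v2 TeX L3272–3273)] -/
theorem smallness_of_single {κ κ₀ H₀ : ℝ} (hκ₀ : 0 ≤ κ₀) (hH₀ : 0 ≤ H₀)
    (hsmall : 2 * Real.exp 1 * K₁ d ^ 2 * κ₀ * Real.exp κ * H₀ ≤ 1) :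
    2 * H₀ * K₁ d * κ₀ * Real.exp (κ - κ₀) ≤ 1 ∧ theta d κ κ₀ H₀ ≤ 1 := by
  have hK₁ := K₁_pos d
  have hK₁1 := one_le_K₁ d
  have he1 : 1 ≤ Real.exp 1 := Real.one_le_exp zero_le_one
  have hk₁ := kappa₁_nonneg d
  constructor
  · calc 2 * H₀ * K₁ d * κ₀ * Real.exp (κ - κ₀) ≤ 2 * H₀ * K₁ d * κ₀ * Real.exp κ := by
          gcongr
          linarith
      _ ≤ 2 * H₀ * K₁ d * κ₀ * Real.exp κ * (Real.exp 1 * K₁ d) :=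
          le_mul_of_one_le_right (by positivity) (one_le_mul_of_one_le_of_one_le he1 hK₁1)
      _ = 2 * Real.exp 1 * K₁ d ^ 2 * κ₀ * Real.exp κ * H₀ := by ring
      _ ≤ 1 := hsmall
  · calc theta d κ κ₀ H₀ = 2 * Real.exp 1 * K₁ d ^ 2 * κ₀ * Real.exp (4 * 2 ^ d + delta d κ κ₀) * H₀ := rfl
      _ ≤ 2 * Real.exp 1 * K₁ d ^ 2 * κ₀ * Real.exp κ * H₀ := by
          gcongr
          simp only [delta]
          linarith
      _ ≤ 1 := hsmall

/-! ### Part 5a. The Kotecký–Preiss bookkeeping for ANY activity obeying the (simplon)-type bound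

Of Dimock's `K` the derivation below uses only the bound (simplon); it is therefore recorded for an arbitrary activity
`w` on the Ω-parts with `‖w(V)‖ ≤ 2e·K₁(d)·κ₀·H₀·e^{−(κ−κ₀−2)·coverLen univ V}` — the form in which it serves both
`K(Y,Φ′,Φ)` at a fixed field (Part 5) and the integrated `K^#(Y,Φ′) = ∫K dμ_Λ` of step 2, which *"again satisfies the
bound (simplon)"* (L7061; Part 7). -/

/-- **THE KOTECKÝ–PREISS SUM FOR AN ACTIVITY WITH THE (simplon)-TYPE BOUND**: if `‖w(V′)‖ ≤ 2eK₁(d)κ₀H₀e^{−(κ−κ₀−2)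
coverLen univ V′}` on the Ω-parts of the regrouped gas, `κ₀ ≥ 0`, `H₀ ≥ 0` and `θ ≤ 1`, then for every Ω-part `V`,
`Σ_{V′ Ω-meets V} ‖w(V′)‖·e^{θ|V′| + δ(coverLen univ V′ + 1)} ≤ θ|V|` ((keykey2) `ninety_of_keykey2` gives `θ|V′| ≤ |V′| ≤
4·2^d(1 + coverLen V′)`, the exponents collect to `e^{4·2^d+δ}e^{−κ₁(d)coverLen V′}`, Part 3 sums over `V′ ∋ □`, `□ ∈ V`).
[cite: Dimock2013BalabanII, App. F Theorem cluster3, proof (arXiv:1212.5562v2 TeX L7046–7049, L7061, L7076–7077)] -/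
theorem kp_sum_le_of_norm_le (Θ : Finset (TPt d N)) (Pol : Finset (Finset (TPt d N)))
    {w : Finset (TPt d N) → ℂ} {κ κ₀ H₀ : ℝ} (hκ₀ : 0 ≤ κ₀) (hH₀ : 0 ≤ H₀)
    (hw : ∀ V ∈ unions (fun X : Finset (TPt d N) => X \ Θ) Pol,
      ‖w V‖ ≤ 2 * Real.exp 1 * K₁ d * κ₀ * H₀ * Real.exp (-(κ - κ₀ - 2) * coverLen Finset.univ V))
    (hθ : theta d κ κ₀ H₀ ≤ 1)
    {V : Finset (TPt d N)} (hV : V ∈ unions (fun X : Finset (TPt d N) => X \ Θ) Pol) :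
    ∑ V' ∈ unions (fun X : Finset (TPt d N) => X \ Θ) Pol with Inc V' V,
        ‖w V'‖ * Real.exp (kpSize (theta d κ κ₀ H₀) V' + kpDecay (delta d κ κ₀) V') ≤
      kpSize (theta d κ κ₀ H₀) V := by
  classical
  set θ := theta d κ κ₀ H₀ with hθdef
  set δ := delta d κ κ₀ with hδdef
  set L := unions (fun X : Finset (TPt d N) => X \ Θ) Pol with hL
  have hK₁ := K₁_pos d
  have hVne : V.Nonempty := nonempty_of_mem_unions hV
  -- the constant in front
  set B : ℝ := 2 * Real.exp 1 * K₁ d * κ₀ * H₀ * Real.exp (4 * 2 ^ d + δ) with hB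
  have hB0 : 0 ≤ B := by positivity
  -- termwise bound
  have hterm : ∀ V' ∈ L.filter (fun V' => Inc V' V),
      ‖w V'‖ * Real.exp (kpSize θ V' + kpDecay δ V') ≤ B * Real.exp (-(kappa₁ d) * coverLen Finset.univ V') := by
    intro V' hV'
    obtain ⟨hV'L, -⟩ := Finset.mem_filter.1 hV'
    have hV'ne : V'.Nonempty := nonempty_of_mem_unions hV'L
    set ℓ := coverLen (Finset.univ : Finset (TPt d N)) V' with hℓ
    have hℓ0 : 0 ≤ ℓ := coverLen_nonneg _ _
    -- (simplon)-type bound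
    have hK := hw V' hV'L
    -- (keykey2): θ|V'| ≤ |V'| ≤ 4·2^d (1 + ℓ)
    have hsize : kpSize θ V' ≤ 4 * 2 ^ d * (1 + ℓ) := by
      have h1 : kpSize θ V' ≤ (V'.card : ℝ) := by
        unfold kpSize
        exact mul_le_of_le_one_left (Nat.cast_nonneg _) hθ
      exact h1.trans (ninety_of_keykey2 (exists_tCover_univ hV'ne))
    have hexp : Real.exp (kpSize θ V' + kpDecay δ V') ≤ Real.exp (4 * 2 ^ d * (1 + ℓ) + δ * (ℓ + 1)) := by
      rw [Real.exp_le_exp]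
      unfold kpDecay
      linarith
    have hcomb : Real.exp (-(κ - κ₀ - 2) * ℓ) * Real.exp (4 * 2 ^ d * (1 + ℓ) + δ * (ℓ + 1)) =
        Real.exp (4 * 2 ^ d + δ) * Real.exp (-(kappa₁ d) * ℓ) := by
      rw [← Real.exp_add, ← Real.exp_add]
      congr 1
      simp only [hδdef, delta]
      ring
    calc ‖w V'‖ * Real.exp (kpSize θ V' + kpDecay δ V')
        ≤ (2 * Real.exp 1 * K₁ d * κ₀ * H₀ * Real.exp (-(κ - κ₀ - 2) * ℓ)) *
            Real.exp (4 * 2 ^ d * (1 + ℓ) + δ * (ℓ + 1)) :=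
          mul_le_mul hK hexp (Real.exp_pos _).le (by positivity)
      _ = B * Real.exp (-(kappa₁ d) * ℓ) := by
          rw [hB, mul_assoc (2 * Real.exp 1 * K₁ d * κ₀ * H₀), hcomb, ← mul_assoc]
  -- the sum over V' Ω-meeting V, by Part 3
  have hcover : ∑ V' ∈ L.filter (fun V' => Inc V' V), Real.exp (-(kappa₁ d) * coverLen Finset.univ V') ≤
      K₁ d * (V.card : ℝ) := by
    have hsub : L.filter (fun V' => Inc V' V) ⊆ L.filter (fun V' => ¬ Disjoint V' V) := by
      intro V' hV'
      obtain ⟨hV'L, hI⟩ := Finset.mem_filter.1 hV'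
      refine Finset.mem_filter.2 ⟨hV'L, ?_⟩
      rcases hI with h | h
      · exact h
      · rw [h, disjoint_self, Finset.bot_eq_empty]
        exact hVne.ne_empty
    exact (Finset.sum_le_sum_of_subset_of_nonneg hsub fun _ _ _ => (Real.exp_pos _).le).trans
      (sum_exp_coverLen_inter_le V L le_rfl)
  calc ∑ V' ∈ L.filter (fun V' => Inc V' V), ‖w V'‖ * Real.exp (kpSize θ V' + kpDecay δ V')
      ≤ ∑ V' ∈ L.filter (fun V' => Inc V' V), B * Real.exp (-(kappa₁ d) * coverLen Finset.univ V') :=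
        Finset.sum_le_sum hterm
    _ = B * ∑ V' ∈ L.filter (fun V' => Inc V' V), Real.exp (-(kappa₁ d) * coverLen Finset.univ V') := by
        rw [Finset.mul_sum]
    _ ≤ B * (K₁ d * (V.card : ℝ)) := mul_le_mul_of_nonneg_left hcover hB0
    _ = kpSize θ V := by
        rw [hθdef, theta, kpSize, hB]
        ring

/-- **KOTECKÝ–PREISS VOLUME FOR AN ACTIVITY WITH THE (simplon)-TYPE BOUND** (`LatticeModels.IsKPVolume` on the gas of
Ω-parts, size `a(V) = θ|V|`), from `kp_sum_le_of_norm_le` by dropping the decay `e^{d(V′)} ≥ 1` (`δ ≥ 0`).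
[cite: Dimock2013BalabanII, App. F Theorem cluster3, proof (arXiv:1212.5562v2 TeX L7063–7077)] -/
theorem isKPVolume_of_norm_le (Θ : Finset (TPt d N)) (Pol : Finset (Finset (TPt d N)))
    {w : Finset (TPt d N) → ℂ} {κ κ₀ H₀ : ℝ} (hκ₀ : 0 ≤ κ₀) (hδ : 0 ≤ delta d κ κ₀) (hH₀ : 0 ≤ H₀)
    (hw : ∀ V ∈ unions (fun X : Finset (TPt d N) => X \ Θ) Pol,
      ‖w V‖ ≤ 2 * Real.exp 1 * K₁ d * κ₀ * H₀ * Real.exp (-(κ - κ₀ - 2) * coverLen Finset.univ V))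
    (hθ : theta d κ κ₀ H₀ ≤ 1) :
    IsKPVolume Inc w (kpSize (theta d κ κ₀ H₀)) (unions (fun X : Finset (TPt d N) => X \ Θ) Pol) := by
  intro V hV
  refine le_trans (Finset.sum_le_sum fun V' _ => ?_) (kp_sum_le_of_norm_le Θ Pol hκ₀ hH₀ hw hθ hV)
  unfold kpTerm
  refine mul_le_mul_of_nonneg_left (Real.exp_le_exp.2 (le_add_of_nonneg_right ?_)) (norm_nonneg _)
  unfold kpDecay
  have := coverLen_nonneg (Finset.univ : Finset (TPt d N)) V'
  positivity

/-- **THE KOTECKÝ–PREISS ESTIMATE (4) FOR AN ACTIVITY WITH THE (simplon)-TYPE BOUND** (tree-PROVED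
`LatticeModels.touchSum_le_of_kp`): `Σ_{𝒞 ⊆ unions, 𝒞 ι V} ‖Φ^T(𝒞)‖·e^{d(𝒞)} ≤ θ|V|` for every Ω-part `V`.
[cite: Dimock2013BalabanII, App. F Theorem cluster3, proof (arXiv:1212.5562v2 TeX L7063–7077)] -/
theorem touchSum_le_of_norm_le (Θ : Finset (TPt d N)) (Pol : Finset (Finset (TPt d N)))
    {w : Finset (TPt d N) → ℂ} {κ κ₀ H₀ : ℝ} (hκ₀ : 0 ≤ κ₀) (hδ : 0 ≤ delta d κ κ₀) (hH₀ : 0 ≤ H₀)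
    (hw : ∀ V ∈ unions (fun X : Finset (TPt d N) => X \ Θ) Pol,
      ‖w V‖ ≤ 2 * Real.exp 1 * K₁ d * κ₀ * H₀ * Real.exp (-(κ - κ₀ - 2) * coverLen Finset.univ V))
    (hθ : theta d κ κ₀ H₀ ≤ 1)
    {V : Finset (TPt d N)} (hV : V ∈ unions (fun X : Finset (TPt d N) => X \ Θ) Pol) :
    touchSum Inc w (kpDecay (delta d κ κ₀)) (unions (fun X : Finset (TPt d N) => X \ Θ) Pol) V ≤
      kpSize (theta d κ κ₀ H₀) V := by
  refine touchSum_le_of_kp (fun V' => ?_) (fun V' => ?_)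
    (fun V' hV' => kp_sum_le_of_norm_le Θ Pol hκ₀ hH₀ hw hθ hV') hV
  · unfold kpSize
    exact mul_nonneg (theta_nonneg hκ₀ hH₀) (Nat.cast_nonneg _)
  · unfold kpDecay
    have := coverLen_nonneg (Finset.univ : Finset (TPt d N)) V'
    positivity

/-- **`‖H^#(V)‖ ≤ θ|V|·e^{−δ(coverLen univ V + 1)}` FOR AN ACTIVITY WITH THE (simplon)-TYPE BOUND**: off clusters
`Φ^T(𝒞) = 0` (*"ρ^T … vanishes if the Y_j are not Ω-connected"*, L7073; tree `truncatedWeight_eq_zero_of_kp`), on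
clusters (otter) for Ω-parts gives `d(𝒞) ≥ δ(coverLen univ V + 1)`, every such `𝒞` touches `V`, and
`touchSum_le_of_norm_le` bounds the weighted sum by `θ|V|`. [cite: Dimock2013BalabanII, App. F Theorem cluster3 eq. (sunshine) (arXiv:1212.5562v2 TeX L6994–6996, L7063–7077)] -/
theorem norm_Hsharp_le_of_norm_le (Θ : Finset (TPt d N)) (Pol : Finset (Finset (TPt d N)))
    {w : Finset (TPt d N) → ℂ} {κ κ₀ H₀ : ℝ} (hκ₀ : 0 ≤ κ₀) (hδ : 0 ≤ delta d κ κ₀) (hH₀ : 0 ≤ H₀)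
    (hw : ∀ V ∈ unions (fun X : Finset (TPt d N) => X \ Θ) Pol,
      ‖w V‖ ≤ 2 * Real.exp 1 * K₁ d * κ₀ * H₀ * Real.exp (-(κ - κ₀ - 2) * coverLen Finset.univ V))
    (hθ : theta d κ κ₀ H₀ ≤ 1)
    {V : Finset (TPt d N)} (hV : V ∈ unions (fun X : Finset (TPt d N) => X \ Θ) Pol) :
    ‖Hsharp (fun X : Finset (TPt d N) => X \ Θ) Pol w V‖ ≤
      kpSize (theta d κ κ₀ H₀) V * Real.exp (-(kpDecay (delta d κ κ₀) V)) := by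
  classical
  set θ := theta d κ κ₀ H₀ with hθdef
  set δ := delta d κ κ₀ with hδdef
  set L := unions (fun X : Finset (TPt d N) => X \ Θ) Pol with hL
  have hVne : V.Nonempty := nonempty_of_mem_unions hV
  have hKP : IsKPVolume Inc w (kpSize θ) L := isKPVolume_of_norm_le Θ Pol hκ₀ hδ hH₀ hw hθ
  have htouch : touchSum Inc w (kpDecay δ) L V ≤ kpSize θ V := touchSum_le_of_norm_le Θ Pol hκ₀ hδ hH₀ hw hθ hV
  -- termwise: ‖Φ^T(𝒞)‖ ≤ e^{−d V} ‖Φ^T(𝒞)‖ e^{d 𝒞} on the families with union V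
  have hterm : ∀ 𝒞 ∈ L.powerset.filter (fun 𝒞 => 𝒞.biUnion id = V),
      ‖truncatedWeight Inc w 𝒞‖ ≤
        Real.exp (-(kpDecay δ V)) * (‖truncatedWeight Inc w 𝒞‖ * Real.exp (∑ V' ∈ 𝒞, kpDecay δ V')) := by
    intro 𝒞 h𝒞
    obtain ⟨h𝒞L, hU⟩ := Finset.mem_filter.1 h𝒞
    rw [Finset.mem_powerset] at h𝒞L
    by_cases hcl : IsPolymerCluster Inc 𝒞
    · have h𝒞ne : 𝒞.Nonempty := by
        rw [Finset.nonempty_iff_ne_empty]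
        rintro rfl
        rw [Finset.biUnion_empty] at hU
        exact hVne.ne_empty hU.symm
      have hdec : kpDecay δ V ≤ ∑ V' ∈ 𝒞, kpDecay δ V' := by
        have h := decay_union_le_sum h𝒞ne (fun V' hV' => nonempty_of_mem_unions (h𝒞L hV')) hcl hδ
        rw [hU] at h
        exact h
      have hone : 1 ≤ Real.exp (-(kpDecay δ V)) * Real.exp (∑ V' ∈ 𝒞, kpDecay δ V') := by
        rw [← Real.exp_add]
        exact Real.one_le_exp (by linarith)
      calc ‖truncatedWeight Inc w 𝒞‖ = ‖truncatedWeight Inc w 𝒞‖ * 1 := (mul_one _).symm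
        _ ≤ ‖truncatedWeight Inc w 𝒞‖ *
              (Real.exp (-(kpDecay δ V)) * Real.exp (∑ V' ∈ 𝒞, kpDecay δ V')) :=
            mul_le_mul_of_nonneg_left hone (norm_nonneg _)
        _ = _ := by ring
    · rw [truncatedWeight_eq_zero_of_kp hKP h𝒞L hcl, norm_zero, zero_mul, mul_zero]
  -- the families with union V touch V
  have hsub : L.powerset.filter (fun 𝒞 => 𝒞.biUnion id = V) ⊆ L.powerset.filter (fun 𝒞 => KPTouches Inc 𝒞 V) := by
    intro 𝒞 h𝒞
    obtain ⟨h𝒞L, hU⟩ := Finset.mem_filter.1 h𝒞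
    refine Finset.mem_filter.2 ⟨h𝒞L, ?_⟩
    obtain ⟨c, hc⟩ := hVne
    rw [← hU] at hc
    obtain ⟨V', hV'𝒞, hcV'⟩ := Finset.mem_biUnion.1 hc
    refine ⟨V', hV'𝒞, Or.inl ?_⟩
    rw [Finset.not_disjoint_iff]
    refine ⟨c, hcV', ?_⟩
    rw [← hU]
    exact Finset.mem_biUnion.2 ⟨V', hV'𝒞, hcV'⟩
  calc ‖Hsharp (fun X : Finset (TPt d N) => X \ Θ) Pol w V‖
      ≤ ∑ 𝒞 ∈ L.powerset.filter (fun 𝒞 => 𝒞.biUnion id = V), ‖truncatedWeight Inc w 𝒞‖ := norm_sum_le _ _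
    _ ≤ ∑ 𝒞 ∈ L.powerset.filter (fun 𝒞 => 𝒞.biUnion id = V),
          Real.exp (-(kpDecay δ V)) * (‖truncatedWeight Inc w 𝒞‖ * Real.exp (∑ V' ∈ 𝒞, kpDecay δ V')) :=
        Finset.sum_le_sum hterm
    _ = Real.exp (-(kpDecay δ V)) * ∑ 𝒞 ∈ L.powerset.filter (fun 𝒞 => 𝒞.biUnion id = V),
          ‖truncatedWeight Inc w 𝒞‖ * Real.exp (∑ V' ∈ 𝒞, kpDecay δ V') := by rw [Finset.mul_sum]
    _ ≤ Real.exp (-(kpDecay δ V)) * touchSum Inc w (kpDecay δ) L V := by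
        refine mul_le_mul_of_nonneg_left ?_ (Real.exp_pos _).le
        unfold touchSum
        exact Finset.sum_le_sum_of_subset_of_nonneg hsub fun _ _ _ =>
          mul_nonneg (norm_nonneg _) (Real.exp_nonneg _)
    _ ≤ Real.exp (-(kpDecay δ V)) * kpSize θ V := mul_le_mul_of_nonneg_left htouch (Real.exp_pos _).le
    _ = kpSize θ V * Real.exp (-(kpDecay δ V)) := mul_comm _ _

/-- **(sunshine) FOR AN ACTIVITY WITH THE (simplon)-TYPE BOUND**: `‖H^#(V)‖ ≤ C♯(d,κ₀)·H₀·e^{−(κ − 3κ₀ − 3)·coverLen univ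
V}` for every Ω-part `V`, under `max(κ₁(d), 4·2^d) ≤ κ₀`, `3κ₀ + 3 ≤ κ`, `0 ≤ H₀` and `2e·K₁(d)²·κ₀·e^{κ}·H₀ ≤ 1` — from
`norm_Hsharp_le_of_norm_le` with `θ|V|e^{−δ(ℓ+1)} = 2eK₁²κ₀e^{4·2^d}H₀·|V|e^{−δℓ}`, `|V| ≤ 4·2^d(1+ℓ) ≤ 4·2^d e^{ℓ}`, `δ − 1 ≥
κ − 3κ₀ − 3`. [cite: Dimock2013BalabanII, App. F Theorem cluster3 eq. (sunshine) (arXiv:1212.5562v2 TeX L6984–6997)] -/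
theorem sunshine_of_norm_le (Θ : Finset (TPt d N)) (Pol : Finset (Finset (TPt d N)))
    {w : Finset (TPt d N) → ℂ} {κ κ₀ H₀ : ℝ} (hκ₁ : kappa₁ d ≤ κ₀) (hκv : 4 * 2 ^ d ≤ κ₀)
    (hκ : 3 * κ₀ + 3 ≤ κ) (hH₀ : 0 ≤ H₀)
    (hw : ∀ V ∈ unions (fun X : Finset (TPt d N) => X \ Θ) Pol,
      ‖w V‖ ≤ 2 * Real.exp 1 * K₁ d * κ₀ * H₀ * Real.exp (-(κ - κ₀ - 2) * coverLen Finset.univ V))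
    (hsmall : 2 * Real.exp 1 * K₁ d ^ 2 * κ₀ * Real.exp κ * H₀ ≤ 1)
    {V : Finset (TPt d N)} (hV : V ∈ unions (fun X : Finset (TPt d N) => X \ Θ) Pol) :
    ‖Hsharp (fun X : Finset (TPt d N) => X \ Θ) Pol w V‖ ≤
      Csharp d κ₀ * H₀ * Real.exp (-(κ - 3 * κ₀ - 3) * coverLen Finset.univ V) := by
  have hκ₀ : 0 ≤ κ₀ := le_trans (by positivity) hκv
  have hK₁ := K₁_pos d
  have hδ1 : κ - 3 * κ₀ - 3 ≤ delta d κ κ₀ - 1 := by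
    simp only [delta]
    linarith
  have hδ : 0 ≤ delta d κ κ₀ := by
    have : (0 : ℝ) ≤ 4 * 2 ^ d := by positivity
    have := kappa₁_nonneg d
    linarith
  obtain ⟨-, hθ⟩ := smallness_of_single (d := d) hκ₀ hH₀ hsmall
  have h := norm_Hsharp_le_of_norm_le Θ Pol hκ₀ hδ hH₀ hw hθ hV
  refine h.trans ?_
  set ℓ := coverLen (Finset.univ : Finset (TPt d N)) V with hℓ
  set δ := delta d κ κ₀ with hδdef
  have hℓ0 : 0 ≤ ℓ := coverLen_nonneg _ _
  have hVne : V.Nonempty := nonempty_of_mem_unions hV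
  -- |V| ≤ 4·2^d (1 + ℓ) ≤ 4·2^d e^ℓ
  have hcard : (V.card : ℝ) ≤ 4 * 2 ^ d * Real.exp ℓ := by
    refine (ninety_of_keykey2 (exists_tCover_univ hVne)).trans ?_
    have := Real.add_one_le_exp ℓ
    have h2 : (0 : ℝ) ≤ 4 * 2 ^ d := by positivity
    nlinarith
  -- θ e^{−δ(ℓ+1)} = 2eK₁²κ₀e^{4·2^d}H₀ · e^{−δℓ}
  have hθexp : theta d κ κ₀ H₀ * Real.exp (-(kpDecay δ V)) =
      2 * Real.exp 1 * K₁ d ^ 2 * κ₀ * Real.exp (4 * 2 ^ d) * H₀ * Real.exp (-δ * ℓ) := by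
    unfold theta kpDecay
    rw [show 2 * Real.exp 1 * K₁ d ^ 2 * κ₀ * Real.exp (4 * 2 ^ d + δ) * H₀ * Real.exp (-(δ * (ℓ + 1))) =
      2 * Real.exp 1 * K₁ d ^ 2 * κ₀ * H₀ * (Real.exp (4 * 2 ^ d + δ) * Real.exp (-(δ * (ℓ + 1)))) by ring,
      ← Real.exp_add,
      show 2 * Real.exp 1 * K₁ d ^ 2 * κ₀ * Real.exp (4 * 2 ^ d) * H₀ * Real.exp (-δ * ℓ) =
      2 * Real.exp 1 * K₁ d ^ 2 * κ₀ * H₀ * (Real.exp (4 * 2 ^ d) * Real.exp (-δ * ℓ)) by ring,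
      ← Real.exp_add]
    congr 2
    ring
  -- e^ℓ e^{−δℓ} ≤ e^{−(κ−3κ₀−3)ℓ}
  have hrate : Real.exp ℓ * Real.exp (-δ * ℓ) ≤ Real.exp (-(κ - 3 * κ₀ - 3) * ℓ) := by
    rw [← Real.exp_add, Real.exp_le_exp]
    nlinarith
  have hA : 0 ≤ 2 * Real.exp 1 * K₁ d ^ 2 * κ₀ * Real.exp (4 * 2 ^ d) * H₀ := by positivity
  calc kpSize (theta d κ κ₀ H₀) V * Real.exp (-(kpDecay δ V))
      = (V.card : ℝ) * (theta d κ κ₀ H₀ * Real.exp (-(kpDecay δ V))) := by unfold kpSize; ring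
    _ = (V.card : ℝ) * (2 * Real.exp 1 * K₁ d ^ 2 * κ₀ * Real.exp (4 * 2 ^ d) * H₀ * Real.exp (-δ * ℓ)) := by
        rw [hθexp]
    _ ≤ (4 * 2 ^ d * Real.exp ℓ) *
          (2 * Real.exp 1 * K₁ d ^ 2 * κ₀ * Real.exp (4 * 2 ^ d) * H₀ * Real.exp (-δ * ℓ)) :=
        mul_le_mul_of_nonneg_right hcard (mul_nonneg hA (Real.exp_pos _).le)
    _ = Csharp d κ₀ * H₀ * (Real.exp ℓ * Real.exp (-δ * ℓ)) := by unfold Csharp; ring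
    _ ≤ Csharp d κ₀ * H₀ * Real.exp (-(κ - 3 * κ₀ - 3) * ℓ) :=
        mul_le_mul_of_nonneg_left hrate (by unfold Csharp; positivity)

/-- (simplon) `HolePolymerKeyBounds.simplon_torus` as the activity hypothesis of Part 5a: Dimock's `K` on the Ω-parts of
the regrouped gas obeys `‖K(V)‖ ≤ 2eK₁(d)κ₀H₀e^{−(κ−κ₀−2)·coverLen univ V}`. [cite: Dimock2013BalabanII, App. F Theorem cluster3, proof eq. (simplon) (arXiv:1212.5562v2 TeX L7046–7049)] -/
theorem norm_K_le_of_mem_unions (Θ : Finset (TPt d N)) {Pol : Finset (Finset (TPt d N))}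
    (hPol : ∀ X ∈ Pol, X.Nonempty ∧ TFaceConnected X ∧ DMod Θ X ∧ (X \ Θ).Nonempty)
    {a : Finset (TPt d N) → ℂ} {κ κ₀ H₀ : ℝ} (hκ₁ : kappa₁ d ≤ κ₀) (hκv : 4 * 2 ^ d ≤ κ₀) (hκ : κ₀ ≤ κ)
    (hH₀ : 0 ≤ H₀) (ha : ∀ X ∈ Pol, ‖a X‖ ≤ 2 * H₀ * Real.exp (-κ * torusTreeLenMod X Θ))
    (hsmall₁ : 2 * H₀ * K₁ d * κ₀ * Real.exp (κ - κ₀) ≤ 1) :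
    ∀ V ∈ unions (fun X : Finset (TPt d N) => X \ Θ) Pol,
      ‖K (fun X : Finset (TPt d N) => X \ Θ) Pol (fun T => ∏ X ∈ T, a X) V‖ ≤
        2 * Real.exp 1 * K₁ d * κ₀ * H₀ * Real.exp (-(κ - κ₀ - 2) * coverLen Finset.univ V) :=
  fun V _ => simplon_torus (𝕜 := ℂ) Θ hPol hκ₁ hκv hκ hH₀ le_rfl ha (by rwa [one_mul]) V

/-- **THE KOTECKÝ–PREISS SUM OF THE GAS OF Ω-PARTS** (the *"further analysis"* of L7076–7077 in the Kotecký–Preiss form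
[KP86] (1)): for polymers with holes `Pol`, activities `‖a X‖ ≤ 2H₀e^{−κ d_M(X, mod Θ)}`, `max(κ₁(d), 4·2^d) ≤ κ₀`, `δ ≥ 0`,
`0 ≤ H₀`, the (simplon)-smallness `2H₀K₁(d)κ₀e^{κ−κ₀} ≤ 1` and `θ ≤ 1`, EVERY Ω-part `V` of the regrouped gas satisfies
`Σ_{V′ Ω-meets V} ‖K(V′)‖·e^{θ|V′| + δ(coverLen univ V′ + 1)} ≤ θ|V|`: (simplon) `simplon_torus` bounds `‖K(V′)‖` by
`2eK₁κ₀H₀e^{−(κ−κ₀−2)coverLen V′}`, (keykey2) `ninety_of_keykey2` gives `θ|V′| ≤ |V′| ≤ 4·2^d(1 + coverLen V′)`, the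
exponents collect to `e^{4·2^d+δ}e^{−κ₁(d)coverLen V′}`, and Part 3 sums over `V′ ∋ □`, `□ ∈ V`. [cite: Dimock2013BalabanII, App. F Theorem cluster3, proof (arXiv:1212.5562v2 TeX L7046–7049, L7076–7077)] -/
theorem kp_sum_le (Θ : Finset (TPt d N)) {Pol : Finset (Finset (TPt d N))}
    (hPol : ∀ X ∈ Pol, X.Nonempty ∧ TFaceConnected X ∧ DMod Θ X ∧ (X \ Θ).Nonempty)
    {a : Finset (TPt d N) → ℂ} {κ κ₀ H₀ : ℝ} (hκ₁ : kappa₁ d ≤ κ₀) (hκv : 4 * 2 ^ d ≤ κ₀)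
    (hδ : 0 ≤ delta d κ κ₀) (hH₀ : 0 ≤ H₀)
    (ha : ∀ X ∈ Pol, ‖a X‖ ≤ 2 * H₀ * Real.exp (-κ * torusTreeLenMod X Θ))
    (hsmall₁ : 2 * H₀ * K₁ d * κ₀ * Real.exp (κ - κ₀) ≤ 1) (hθ : theta d κ κ₀ H₀ ≤ 1)
    {V : Finset (TPt d N)} (hV : V ∈ unions (fun X : Finset (TPt d N) => X \ Θ) Pol) :
    ∑ V' ∈ unions (fun X : Finset (TPt d N) => X \ Θ) Pol with Inc V' V,
        ‖K (fun X : Finset (TPt d N) => X \ Θ) Pol (fun T => ∏ X ∈ T, a X) V'‖ *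
          Real.exp (kpSize (theta d κ κ₀ H₀) V' + kpDecay (delta d κ κ₀) V') ≤
      kpSize (theta d κ κ₀ H₀) V := by
  have hκ₀ : 0 ≤ κ₀ := le_trans (by positivity) hκv
  have hκ : κ₀ ≤ κ := by
    have := kappa₁_nonneg d
    have h2 : (0 : ℝ) ≤ 4 * 2 ^ d := by positivity
    have hδ' := hδ
    simp only [delta] at hδ'
    linarith
  exact kp_sum_le_of_norm_le Θ Pol hκ₀ hH₀ (norm_K_le_of_mem_unions Θ hPol hκ₁ hκv hκ hH₀ ha hsmall₁) hθ hV

/-- **THE GAS OF Ω-PARTS IS A KOTECKÝ–PREISS VOLUME** (`LatticeModels.IsKPVolume`, size `a(V) = θ|V|`): the hypothesis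
under which the App. B kernel `MayerExpansion` §5 exponentiates (from `kp_sum_le`, dropping the decay `e^{d(V′)} ≥ 1`).
[cite: Dimock2013BalabanII, App. F Theorem cluster3, proof (arXiv:1212.5562v2 TeX L7063–7077)] -/
theorem isKPVolume_holes (Θ : Finset (TPt d N)) {Pol : Finset (Finset (TPt d N))}
    (hPol : ∀ X ∈ Pol, X.Nonempty ∧ TFaceConnected X ∧ DMod Θ X ∧ (X \ Θ).Nonempty)
    {a : Finset (TPt d N) → ℂ} {κ κ₀ H₀ : ℝ} (hκ₁ : kappa₁ d ≤ κ₀) (hκv : 4 * 2 ^ d ≤ κ₀)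
    (hδ : 0 ≤ delta d κ κ₀) (hH₀ : 0 ≤ H₀)
    (ha : ∀ X ∈ Pol, ‖a X‖ ≤ 2 * H₀ * Real.exp (-κ * torusTreeLenMod X Θ))
    (hsmall₁ : 2 * H₀ * K₁ d * κ₀ * Real.exp (κ - κ₀) ≤ 1) (hθ : theta d κ κ₀ H₀ ≤ 1) :
    IsKPVolume Inc (K (fun X : Finset (TPt d N) => X \ Θ) Pol (fun T => ∏ X ∈ T, a X))
      (kpSize (theta d κ κ₀ H₀)) (unions (fun X : Finset (TPt d N) => X \ Θ) Pol) := by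
  have hκ₀ : 0 ≤ κ₀ := le_trans (by positivity) hκv
  have hκ : κ₀ ≤ κ := by
    have := kappa₁_nonneg d
    have h2 : (0 : ℝ) ≤ 4 * 2 ^ d := by positivity
    have hδ' := hδ
    simp only [delta] at hδ'
    linarith
  exact isKPVolume_of_norm_le Θ Pol hκ₀ hδ hH₀ (norm_K_le_of_mem_unions Θ hPol hκ₁ hκv hκ hH₀ ha hsmall₁) hθ

/-- **THE KOTECKÝ–PREISS ESTIMATE (4) FOR THE GAS OF Ω-PARTS** (tree-PROVED `LatticeModels.touchSum_le_of_kp`): for every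
Ω-part `V` of the regrouped gas, `Σ_{𝒞 ⊆ unions, 𝒞 ι V} ‖Φ^T(𝒞)‖·e^{d(𝒞)} ≤ θ|V|` with `d(𝒞) = Σ_{V′∈𝒞} δ(coverLen univ V′
+ 1)` — the convergence *"of the series"* (L7076–7077) with its decay bookkeeping. [cite: Dimock2013BalabanII, App. F Theorem cluster3, proof (arXiv:1212.5562v2 TeX L7063–7077)] -/
theorem touchSum_le_holes (Θ : Finset (TPt d N)) {Pol : Finset (Finset (TPt d N))}
    (hPol : ∀ X ∈ Pol, X.Nonempty ∧ TFaceConnected X ∧ DMod Θ X ∧ (X \ Θ).Nonempty)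
    {a : Finset (TPt d N) → ℂ} {κ κ₀ H₀ : ℝ} (hκ₁ : kappa₁ d ≤ κ₀) (hκv : 4 * 2 ^ d ≤ κ₀)
    (hδ : 0 ≤ delta d κ κ₀) (hH₀ : 0 ≤ H₀)
    (ha : ∀ X ∈ Pol, ‖a X‖ ≤ 2 * H₀ * Real.exp (-κ * torusTreeLenMod X Θ))
    (hsmall₁ : 2 * H₀ * K₁ d * κ₀ * Real.exp (κ - κ₀) ≤ 1) (hθ : theta d κ κ₀ H₀ ≤ 1)
    {V : Finset (TPt d N)} (hV : V ∈ unions (fun X : Finset (TPt d N) => X \ Θ) Pol) :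
    touchSum Inc (K (fun X : Finset (TPt d N) => X \ Θ) Pol (fun T => ∏ X ∈ T, a X))
        (kpDecay (delta d κ κ₀)) (unions (fun X : Finset (TPt d N) => X \ Θ) Pol) V ≤
      kpSize (theta d κ κ₀ H₀) V := by
  have hκ₀ : 0 ≤ κ₀ := le_trans (by positivity) hκv
  have hκ : κ₀ ≤ κ := by
    have := kappa₁_nonneg d
    have h2 : (0 : ℝ) ≤ 4 * 2 ^ d := by positivity
    have hδ' := hδ
    simp only [delta] at hδ'
    linarith
  exact touchSum_le_of_norm_le Θ Pol hκ₀ hδ hH₀ (norm_K_le_of_mem_unions Θ hPol hκ₁ hκv hκ hH₀ ha hsmall₁) hθ hV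

end KP

/-! ## Part 6. THEOREM F.1 at a fixed field: (gog2) and (sunshine) on the torus -/

section TheoremF1

variable {d N : ℕ} [NeZero N]

/-- **`‖H^#(V)‖ ≤ θ|V|·e^{−δ(coverLen univ V + 1)}`** for every Ω-part `V` of the regrouped gas: `H^#(V)` sums the
truncated functionals `Φ^T(𝒞)` of the sub-families `𝒞` of Ω-parts with `∪𝒞 = V` (`MayerExpansion.Hsharp`); off clusters
`Φ^T(𝒞) = 0` (*"ρ^T … vanishes if the Y_j are not Ω-connected"*, L7073; tree `truncatedWeight_eq_zero_of_kp`), on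
clusters (otter) for Ω-parts gives `d(𝒞) ≥ δ(coverLen univ V + 1)`, every such `𝒞` touches `V`, and the Kotecký–Preiss
estimate `touchSum_le_holes` bounds the weighted sum by `θ|V|`. [cite: Dimock2013BalabanII, App. F Theorem cluster3 eq. (sunshine) (arXiv:1212.5562v2 TeX L6994–6996, L7063–7077)] -/
theorem norm_Hsharp_le (Θ : Finset (TPt d N)) {Pol : Finset (Finset (TPt d N))}
    (hPol : ∀ X ∈ Pol, X.Nonempty ∧ TFaceConnected X ∧ DMod Θ X ∧ (X \ Θ).Nonempty)
    {a : Finset (TPt d N) → ℂ} {κ κ₀ H₀ : ℝ} (hκ₁ : kappa₁ d ≤ κ₀) (hκv : 4 * 2 ^ d ≤ κ₀)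
    (hδ : 0 ≤ delta d κ κ₀) (hH₀ : 0 ≤ H₀)
    (ha : ∀ X ∈ Pol, ‖a X‖ ≤ 2 * H₀ * Real.exp (-κ * torusTreeLenMod X Θ))
    (hsmall₁ : 2 * H₀ * K₁ d * κ₀ * Real.exp (κ - κ₀) ≤ 1) (hθ : theta d κ κ₀ H₀ ≤ 1)
    {V : Finset (TPt d N)} (hV : V ∈ unions (fun X : Finset (TPt d N) => X \ Θ) Pol) :
    ‖Hsharp (fun X : Finset (TPt d N) => X \ Θ) Pol
        (K (fun X : Finset (TPt d N) => X \ Θ) Pol (fun T => ∏ X ∈ T, a X)) V‖ ≤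
      kpSize (theta d κ κ₀ H₀) V * Real.exp (-(kpDecay (delta d κ κ₀) V)) := by
  have hκ₀ : 0 ≤ κ₀ := le_trans (by positivity) hκv
  have hκ : κ₀ ≤ κ := by
    have := kappa₁_nonneg d
    have h2 : (0 : ℝ) ≤ 4 * 2 ^ d := by positivity
    have hδ' := hδ
    simp only [delta] at hδ'
    linarith
  exact norm_Hsharp_le_of_norm_le Θ Pol hκ₀ hδ hH₀ (norm_K_le_of_mem_unions Θ hPol hκ₁ hκv hκ hH₀ ha hsmall₁) hθ hV

/-- **(sunshine) ON THE TORUS** — [Dimock2013BalabanII] THEOREM F.1, verbatim (L6994–6996): *"|H^#(Y,Φ′)| ≤ 𝒪(1) H_0 e^{−(κ −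
3κ_0 − 3) d_M(Y, mod Ω^c)}"* — PROVED at a fixed field for the regrouped gas of Ω-parts: for polymers with holes `Pol`
(non-empty, face-connected, `DMod Θ X`, non-empty Ω-part), activities `‖a X‖ ≤ 2H₀e^{−κ d_M(X, mod Θ)}`, `max(κ₁(d), 4·2^d)
≤ κ₀`, `3κ₀ + 3 ≤ κ`, `0 ≤ H₀` and the smallness `2e·K₁(d)²·κ₀·e^{κ}·H₀ ≤ 1` (*"c_0 sufficiently small"*, depending on `κ` as
part I L3273 says): for EVERY Ω-part `V`, `‖H^#(V)‖ ≤ C♯(d,κ₀)·H₀·e^{−(κ − 3κ₀ − 3)·coverLen univ V}`, `C♯ = 8e·2^d·K₁(d)²·κ₀·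
e^{4·2^d}` (from `norm_Hsharp_le`: `θ|V|e^{−δ(ℓ+1)} = 2eK₁²κ₀e^{4·2^d}H₀·|V|e^{−δℓ}`, `|V| ≤ 4·2^d(1+ℓ) ≤ 4·2^d e^{ℓ}`, `δ − 1 ≥
κ − 3κ₀ − 3`).  READING (declared): indexing by `V = Y ∩ Ω` and decay in `coverLen univ V ≤ d_M(Y, mod Θ)`.
[cite: Dimock2013BalabanII, App. F Theorem cluster3 eq. (sunshine) (arXiv:1212.5562v2 TeX L6984–6997)] -/
theorem sunshine (Θ : Finset (TPt d N)) {Pol : Finset (Finset (TPt d N))}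
    (hPol : ∀ X ∈ Pol, X.Nonempty ∧ TFaceConnected X ∧ DMod Θ X ∧ (X \ Θ).Nonempty)
    {a : Finset (TPt d N) → ℂ} {κ κ₀ H₀ : ℝ} (hκ₁ : kappa₁ d ≤ κ₀) (hκv : 4 * 2 ^ d ≤ κ₀)
    (hκ : 3 * κ₀ + 3 ≤ κ) (hH₀ : 0 ≤ H₀)
    (ha : ∀ X ∈ Pol, ‖a X‖ ≤ 2 * H₀ * Real.exp (-κ * torusTreeLenMod X Θ))
    (hsmall : 2 * Real.exp 1 * K₁ d ^ 2 * κ₀ * Real.exp κ * H₀ ≤ 1)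
    {V : Finset (TPt d N)} (hV : V ∈ unions (fun X : Finset (TPt d N) => X \ Θ) Pol) :
    ‖Hsharp (fun X : Finset (TPt d N) => X \ Θ) Pol
        (K (fun X : Finset (TPt d N) => X \ Θ) Pol (fun T => ∏ X ∈ T, a X)) V‖ ≤
      Csharp d κ₀ * H₀ * Real.exp (-(κ - 3 * κ₀ - 3) * coverLen Finset.univ V) := by
  have hκ₀ : 0 ≤ κ₀ := le_trans (by positivity) hκv
  have hκ' : κ₀ ≤ κ := by linarith
  obtain ⟨hsmall₁, -⟩ := smallness_of_single (d := d) hκ₀ hH₀ hsmall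
  exact sunshine_of_norm_le Θ Pol hκ₁ hκv hκ hH₀ (norm_K_le_of_mem_unions Θ hPol hκ₁ hκv hκ' hH₀ ha hsmall₁)
    hsmall hV

/-- **(gog2) ON THE TORUS, AT A FIXED FIELD** — [Dimock2013BalabanII] THEOREM F.1, verbatim (L6990–6992): *"Ξ = exp( Σ_{Y ∈
𝒟_k(mod Ω^c), Y ∩ Λ ≠ ∅} H^#(Y,Φ′) )"* with `Ξ = ∫exp(Σ_X H(X,Φ′,Φ))dμ_Λ(Φ)` (gog1) — here for a Dirac `μ_Λ` (step 2 not
typed): for polymers with holes `Pol`, `‖H(X)‖ ≤ H₀e^{−κ d_M(X, mod Θ)}` on `Pol`, `0 ≤ H₀ ≤ log 2`, `max(κ₁(d), 4·2^d) ≤ κ₀`,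
`3κ₀ + 3 ≤ κ` and `2e·K₁(d)²·κ₀·e^{κ}·H₀ ≤ 1`:  `exp(Σ_{X∈Pol} H(X)) = exp(Σ_V H^#(V))`, `V` over the unions of sub-families of
Ω-parts, `H^#` Dimock's (hstar) in the Kotecký–Preiss form of the App. B kernel (`MayerExpansion.Hsharp`) for the
regrouped activities `K(V) = Σ_{{X_i} Ω-connected, ∪(X_i ∩ Ω) = V} Π(e^{H(X_i)} − 1)`. [cite: Dimock2013BalabanII, App. F Theorem cluster3 eq. (gog2) (arXiv:1212.5562v2 TeX L6984–6992)] -/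
theorem gog2 (Θ : Finset (TPt d N)) {Pol : Finset (Finset (TPt d N))}
    (hPol : ∀ X ∈ Pol, X.Nonempty ∧ TFaceConnected X ∧ DMod Θ X ∧ (X \ Θ).Nonempty)
    {H : Finset (TPt d N) → ℂ} {κ κ₀ H₀ : ℝ} (hκ₁ : kappa₁ d ≤ κ₀) (hκv : 4 * 2 ^ d ≤ κ₀)
    (hκ : 3 * κ₀ + 3 ≤ κ) (hH₀ : 0 ≤ H₀) (hlog : H₀ ≤ Real.log 2)
    (hH : ∀ X ∈ Pol, ‖H X‖ ≤ H₀ * Real.exp (-κ * torusTreeLenMod X Θ))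
    (hsmall : 2 * Real.exp 1 * K₁ d ^ 2 * κ₀ * Real.exp κ * H₀ ≤ 1) :
    Complex.exp (∑ X ∈ Pol, H X) =
      Complex.exp (∑ V ∈ (unions (fun X : Finset (TPt d N) => X \ Θ) Pol).powerset.image (fun 𝒞 => 𝒞.biUnion id),
        Hsharp (fun X : Finset (TPt d N) => X \ Θ) Pol
          (K (fun X : Finset (TPt d N) => X \ Θ) Pol fun T => ∏ X ∈ T, (Complex.exp (H X) - 1)) V) := by
  have hκ₀ : 0 ≤ κ₀ := le_trans (by positivity) hκv
  have hκ0 : 0 ≤ κ := by linarith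
  have hδ : 0 ≤ delta d κ κ₀ := by
    have : (0 : ℝ) ≤ 4 * 2 ^ d := by positivity
    have := kappa₁_nonneg d
    simp only [delta]
    linarith
  obtain ⟨hsmall₁, hθ⟩ := smallness_of_single (d := d) hκ₀ hH₀ hsmall
  have ha := weight_le_of_mem Θ hH₀ hlog hκ0 hH
  exact cexp_sum_eq_cexp_sum_Hsharp_of_pol (0 : TPt d N) (fun X hX => (hPol X hX).2.2.2) H
    (isKPVolume_holes Θ hPol hκ₁ hκv hδ hH₀ ha hsmall₁ hθ)

/-- (sunshine) for the activities `e^{H(X)} − 1` of (gog2): `‖H^#(V)‖ ≤ C♯(d,κ₀)·H₀·e^{−(κ−3κ₀−3)·coverLen univ V}` for every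
Ω-part `V` — THEOREM F.1's two conclusions together, at a fixed field. [cite: Dimock2013BalabanII, App. F Theorem cluster3 (arXiv:1212.5562v2 TeX L6984–6997)] -/
theorem sunshine_of_H (Θ : Finset (TPt d N)) {Pol : Finset (Finset (TPt d N))}
    (hPol : ∀ X ∈ Pol, X.Nonempty ∧ TFaceConnected X ∧ DMod Θ X ∧ (X \ Θ).Nonempty)
    {H : Finset (TPt d N) → ℂ} {κ κ₀ H₀ : ℝ} (hκ₁ : kappa₁ d ≤ κ₀) (hκv : 4 * 2 ^ d ≤ κ₀)
    (hκ : 3 * κ₀ + 3 ≤ κ) (hH₀ : 0 ≤ H₀) (hlog : H₀ ≤ Real.log 2)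
    (hH : ∀ X ∈ Pol, ‖H X‖ ≤ H₀ * Real.exp (-κ * torusTreeLenMod X Θ))
    (hsmall : 2 * Real.exp 1 * K₁ d ^ 2 * κ₀ * Real.exp κ * H₀ ≤ 1)
    {V : Finset (TPt d N)} (hV : V ∈ unions (fun X : Finset (TPt d N) => X \ Θ) Pol) :
    ‖Hsharp (fun X : Finset (TPt d N) => X \ Θ) Pol
        (K (fun X : Finset (TPt d N) => X \ Θ) Pol fun T => ∏ X ∈ T, (Complex.exp (H X) - 1)) V‖ ≤
      Csharp d κ₀ * H₀ * Real.exp (-(κ - 3 * κ₀ - 3) * coverLen Finset.univ V) := by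
  have hκ0 : 0 ≤ κ := by
    have : (0 : ℝ) ≤ κ₀ := le_trans (by positivity) hκv
    linarith
  exact sunshine Θ hPol hκ₁ hκv hκ hH₀ (weight_le_of_mem Θ hH₀ hlog hκ0 hH) hsmall hV

/-- **NON-VACUITY OF THE PARAMETER REGIME**: for every dimension there are `κ₀`, `κ` and `H₀ > 0` satisfying every
parameter hypothesis of `gog2`∕`sunshine` (`κ₁(d) ≤ κ₀`, `4·2^d ≤ κ₀`, `3κ₀ + 3 ≤ κ`, `0 ≤ H₀ ≤ log 2`,
`2e·K₁(d)²·κ₀·e^{κ}·H₀ ≤ 1`): `κ₀ = κ₁(d) + 4·2^d`, `κ = 3κ₀ + 3`, `H₀ = 1∕(2e·K₁(d)²·κ₀·e^{κ})` (≤ `½` ≤ `log 2`) — the printed hypotheses *"Let c_0 = 𝒪(1) be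
sufficiently small, let H_0 ≤ c_0, let κ ≥ 3κ_0 + 3"* (L6984) are consistent in this module's explicit form. [cite: Dimock2013BalabanII, App. F Theorem cluster3 (arXiv:1212.5562v2 TeX L6984–6985)] -/
theorem regime_nonempty (d : ℕ) : ∃ κ₀ κ H₀ : ℝ, kappa₁ d ≤ κ₀ ∧ 4 * 2 ^ d ≤ κ₀ ∧ 3 * κ₀ + 3 ≤ κ ∧ 0 < H₀ ∧
    H₀ ≤ Real.log 2 ∧ 2 * Real.exp 1 * K₁ d ^ 2 * κ₀ * Real.exp κ * H₀ ≤ 1 := by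
  have hk₁ := kappa₁_nonneg d
  have hK₁ := K₁_pos d
  have hK₁1 := one_le_K₁ d
  set κ₀ : ℝ := kappa₁ d + 4 * 2 ^ d with hκ₀
  set κ : ℝ := 3 * κ₀ + 3 with hκ
  set D : ℝ := 2 * Real.exp 1 * K₁ d ^ 2 * κ₀ * Real.exp κ with hD
  have h4 : (4 : ℝ) ≤ κ₀ := by
    have : (1 : ℝ) ≤ 2 ^ d := one_le_pow₀ (by norm_num)
    rw [hκ₀]; nlinarith
  have hκ₀pos : 0 < κ₀ := by linarith
  have hDpos : 0 < D := by rw [hD]; positivity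
  -- D ≥ 2e·4 ≥ 2, so 1/D ≤ 1/2 ≤ log 2
  have hD2 : 2 ≤ D := by
    have he1 : 1 ≤ Real.exp 1 := Real.one_le_exp zero_le_one
    have heκ : 1 ≤ Real.exp κ := Real.one_le_exp (by rw [hκ]; linarith)
    have hK2 : 1 ≤ K₁ d ^ 2 := one_le_pow₀ hK₁1
    rw [hD]
    calc (2 : ℝ) = 2 * 1 * 1 * 1 * 1 := by ring
      _ ≤ 2 * Real.exp 1 * K₁ d ^ 2 * κ₀ * Real.exp κ := by
          gcongr
          linarith
  refine ⟨κ₀, κ, 1 / D, by rw [hκ₀]; linarith [show (0:ℝ) ≤ 4 * 2 ^ d by positivity], by rw [hκ₀]; linarith,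
    le_rfl, div_pos one_pos hDpos, ?_, ?_⟩
  · have hlog2 : (1 : ℝ) / 2 ≤ Real.log 2 := by
      have := Real.log_two_gt_d9
      linarith
    exact (one_div_le_one_div_of_le two_pos hD2).trans hlog2
  · rw [← hD, mul_one_div_cancel hDpos.ne']

end TheoremF1

/-! ## Part 7 (v1.1). Step 2 typed: THEOREM F.1 WITH ITS INTEGRATION over an ultralocal measure

The remaining step of the printed proof (L7051–7061): *"Because the Y_j ∩ Ω are disjoint, the Y_j ∩ Λ are disjoint. Since
K(Y,Φ′Φ) depends on Φ only in Y_i ∩ Λ, and because fields at different sites are independent random variables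
∫(Σ_{{Y_j}} Π_j K(Y_j,Φ′,Φ)) dμ_Λ(Φ) = Σ_{{Y_j}} Π_j K^#(Y_j,Φ′)  where  K^#(Y,Φ′) = ∫K(Y,Φ′,Φ)dμ_Λ(Φ)  again satisfies
the bound (simplon)."*  MODEL (reading (vii)): one field variable per unit cube of the torus with values in an ARBITRARY
measurable space `E` (so a cube may carry any finite collection of lattice sites: `E` a product), `Φ : TPt d N → E`, the
ultralocal measure `μ_Λ = ⊗_c ν_c` (`MeasureTheory.Measure.pi ν`, each `ν_c` a probability measure; L6979 *"an ultralocal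
probability measure on the fields Φ: Λ → ℝ rendering them independent random variables"*); `H(X,Φ′,Φ)` at fixed `Φ′` is
`H X : (TPt d N → E) → ℝ`, measurable, depending on `Φ` only through the cubes of `X ∩ Λ` with `Λ ∩ Ω^c = ∅` (L6973 *"Λ ⊂
Ω"*, L6981 *"H(X,Φ′,Φ) depends on Φ′, Φ only in X"*).  The factorisation is the sibling's abstract kernel
`UltralocalFactorization.integral_prod_polymers` (part I step 2); the bound on `K^#` is its `abs_integral_le_of_abs_le`. -/

section Congr2

variable {P C : Type*} [DecidableEq C]

/-- The families of disjoint polymers `famD` only see the supports of the members of `Pol`. [cite: Dimock2013, App. B Theorem cluster, proof step 1 (arXiv:1108.1335v2 TeX L3204–3225)] -/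
theorem famD_congr {supp supp' : P → Finset C} {Pol : Finset P} (h : ∀ X ∈ Pol, supp X = supp' X) :
    famD supp Pol = famD supp' Pol := by
  have hi : Pol.powerset.image (U supp) = Pol.powerset.image (U supp') :=
    Finset.image_congr fun T hT => U_congr fun X hX => h X (Finset.mem_powerset.1 (Finset.mem_coe.1 hT) hX)
  unfold famD
  rw [hi]

/-- **STEP 1 OF THE APP. B KERNEL (real weights) WITH SUPPORTS NON-EMPTY ON `Pol` ONLY**: `exp(Σ_{X∈Pol} H(X)) = Σ_{{Y_j}}
Π_j K(Y_j)` (`MayerExpansion.exp_sum_eq_mayer`, whose global support hypothesis is relaxed as in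
`cexp_sum_eq_cexp_sum_Hsharp_of_pol`). [cite: Dimock2013, App. B Theorem cluster, proof step 1 (arXiv:1108.1335v2 TeX L3204–3219)] -/
theorem exp_sum_eq_mayer_of_pol [DecidableEq P] (c : C) {supp : P → Finset C} {Pol : Finset P}
    (hsupp : ∀ X ∈ Pol, (supp X).Nonempty) (H : P → ℝ) :
    Real.exp (∑ X ∈ Pol, H X) =
      ∑ 𝒴 ∈ famD supp Pol, ∏ Y ∈ 𝒴, K supp Pol (fun T => ∏ X ∈ T, (Real.exp (H X) - 1)) Y := by
  classical
  let supp' : P → Finset C := fun X => if X ∈ Pol then supp X else {c}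
  have h : ∀ X ∈ Pol, supp' X = supp X := fun X hX => by simp [supp', hX]
  have hne : ∀ X, (supp' X).Nonempty := fun X => by
    by_cases hX : X ∈ Pol
    · rw [h X hX]; exact hsupp X hX
    · simp [supp', hX]
  have e1 := exp_sum_eq_mayer (Pol := Pol) hne H
  rw [K_congr h, famD_congr h] at e1
  exact e1

/-- **The regrouped sum over disjoint Ω-parts is the hard-core partition function, for ANY activity** (the sibling's
`MayerExpansion.sum_famD_eq_polymerPartitionFunction` is stated for the activities `K`; the same three lines prove it for
every `w`, in particular for the integrated `K^#`): `Σ_{{Y_j}∈famD} Π_j w(Y_j) = Ξ_{unions}(w)`. [cite: Dimock2013, App. B Theorem cluster, proof steps 1–3 (arXiv:1108.1335v2 TeX L3204–3225, L3299–3330)] -/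
theorem sum_famD_prod_eq_polymerPartitionFunction {supp : P → Finset C} {Pol : Finset P} (w : Finset C → ℂ) :
    ∑ 𝒴 ∈ famD supp Pol, ∏ Y ∈ 𝒴, w Y = polymerPartitionFunction Inc w (unions supp Pol) := by
  unfold polymerPartitionFunction
  rw [← Finset.sum_filter]
  refine Finset.sum_congr ?_ fun _ _ => rfl
  ext 𝒴
  rw [mem_famD_iff_isCompatible, Finset.mem_filter, Finset.mem_powerset]

end Congr2

section Integrated

variable {d N : ℕ} [NeZero N] {E : Type*}

/-- Dimock's `K(Y,Φ′,Φ)` at the field `Φ` (real activities `e^{H(X,Φ)} − 1`), indexed by the Ω-part `V = Y ∩ Ω` (L7031–7035: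
*"K(Y) = Σ_{{X_i}: ∪_i X_i = Y} Π_i (e^{H(X_i)} − 1) … K(Y) = K(Y,Φ′,Φ) only depends on Φ′ in Y and Φ in Y ∩ Λ"*).
[cite: Dimock2013BalabanII, App. F Theorem cluster3, proof (arXiv:1212.5562v2 TeX L7025–7035)] -/
def Kfield (Θ : Finset (TPt d N)) (Pol : Finset (Finset (TPt d N))) (H : Finset (TPt d N) → (TPt d N → E) → ℝ)
    (V : Finset (TPt d N)) (Φ : TPt d N → E) : ℝ :=
  K (fun X : Finset (TPt d N) => X \ Θ) Pol (fun T => ∏ X ∈ T, (Real.exp (H X Φ) - 1)) V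

omit [NeZero N] in
/-- **`K(Y,Φ′,Φ)` DEPENDS ON `Φ` ONLY IN `Y ∩ Λ`** (L7035): if each `H(X, ·)` depends on the field only through the cubes of
`X ∩ Λ` and `Λ` avoids the holes, then `K(V, ·)` depends on the field only in the Ω-part `V` (indeed in `V ∩ Λ`).
[cite: Dimock2013BalabanII, App. F Theorem cluster3, proof (arXiv:1212.5562v2 TeX L7031–7035)] -/
theorem dependsOn_Kfield (Θ Λ : Finset (TPt d N)) (hΛ : Disjoint Λ Θ) {Pol : Finset (Finset (TPt d N))}
    {H : Finset (TPt d N) → (TPt d N → E) → ℝ} (hHd : ∀ X ∈ Pol, DependsOn (H X) ((X ∩ Λ : Finset (TPt d N)) : Set (TPt d N)))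
    (V : Finset (TPt d N)) : DependsOn (Kfield Θ Pol H V) ((V : Finset (TPt d N)) : Set (TPt d N)) := by
  intro Φ Ψ hΦΨ
  show (∑ T ∈ covers (fun X : Finset (TPt d N) => X \ Θ) Pol V, ∏ X ∈ T, (Real.exp (H X Φ) - 1)) =
    ∑ T ∈ covers (fun X : Finset (TPt d N) => X \ Θ) Pol V, ∏ X ∈ T, (Real.exp (H X Ψ) - 1)
  refine Finset.sum_congr rfl fun T hT => Finset.prod_congr rfl fun X hX => ?_
  obtain ⟨hTP, -, hU⟩ := mem_covers.1 hT
  have hsub : X ∩ Λ ⊆ V := by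
    intro c hc
    rw [Finset.mem_inter] at hc
    have hcΘ : c ∉ Θ := Finset.disjoint_left.1 hΛ hc.2
    rw [← hU]
    exact Finset.mem_biUnion.2 ⟨X, hX, Finset.mem_sdiff.2 ⟨hc.1, hcΘ⟩⟩
  rw [hHd X (hTP hX) (fun c hc => hΦΨ c (Finset.mem_coe.2 (hsub (Finset.mem_coe.1 hc))))]

omit [NeZero N] in
/-- The real activity bound on `Pol` at each field from the field bound `|H(X,Φ)| ≤ H₀e^{−κ d_M(X, mod Θ)}` (`0 ≤ H₀ ≤ log
2`): `|e^{H(X,Φ)} − 1| ≤ 2H₀e^{−κ d_M(X, mod Θ)}` (part I L3234–3236). [cite: Dimock2013, App. B Theorem cluster, proof step 1 (arXiv:1108.1335v2 TeX L3234–3237)] -/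
theorem abs_weight_le_of_mem (Θ : Finset (TPt d N)) {Pol : Finset (Finset (TPt d N))}
    {H : Finset (TPt d N) → (TPt d N → E) → ℝ} {H₀ κ : ℝ} (hH₀ : 0 ≤ H₀) (hlog : H₀ ≤ Real.log 2) (hκ : 0 ≤ κ)
    (hH : ∀ X ∈ Pol, ∀ Φ, |H X Φ| ≤ H₀ * Real.exp (-κ * torusTreeLenMod X Θ)) (Φ : TPt d N → E) :
    ∀ X ∈ Pol, ‖Real.exp (H X Φ) - 1‖ ≤ 2 * H₀ * Real.exp (-κ * torusTreeLenMod X Θ) := by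
  intro X hX
  have hexp : Real.exp (-κ * torusTreeLenMod X Θ) ≤ 1 := by
    rw [Real.exp_le_one_iff]
    nlinarith [torusTreeLenMod_nonneg X Θ]
  have hlog1 : Real.log 2 ≤ 1 := by
    have := Real.log_two_lt_d9
    linarith
  have h1 : |H X Φ| ≤ 1 := (hH X hX Φ).trans (((mul_le_of_le_one_right hH₀ hexp).trans hlog).trans hlog1)
  rw [Real.norm_eq_abs]
  calc |Real.exp (H X Φ) - 1| ≤ 2 * |H X Φ| := Real.abs_exp_sub_one_le h1
    _ ≤ 2 * (H₀ * Real.exp (-κ * torusTreeLenMod X Θ)) := by linarith [hH X hX Φ]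
    _ = 2 * H₀ * Real.exp (-κ * torusTreeLenMod X Θ) := by ring

/-- **(simplon) AT EACH FIELD**: `|K(V,Φ)| ≤ 2eK₁(d)κ₀H₀e^{−(κ−κ₀−2)·coverLen univ V}` on the whole field space (*"on the support of
μ_Λ"*, L7046), by `simplon_torus` with the real activities `e^{H(X,Φ)} − 1`. [cite: Dimock2013BalabanII, App. F Theorem cluster3, proof eq. (simplon) (arXiv:1212.5562v2 TeX L7046–7049)] -/
theorem abs_Kfield_le (Θ : Finset (TPt d N)) {Pol : Finset (Finset (TPt d N))}
    (hPol : ∀ X ∈ Pol, X.Nonempty ∧ TFaceConnected X ∧ DMod Θ X ∧ (X \ Θ).Nonempty)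
    {H : Finset (TPt d N) → (TPt d N → E) → ℝ} {κ κ₀ H₀ : ℝ} (hκ₁ : kappa₁ d ≤ κ₀) (hκv : 4 * 2 ^ d ≤ κ₀)
    (hκ : κ₀ ≤ κ) (hH₀ : 0 ≤ H₀) (hlog : H₀ ≤ Real.log 2)
    (hH : ∀ X ∈ Pol, ∀ Φ, |H X Φ| ≤ H₀ * Real.exp (-κ * torusTreeLenMod X Θ))
    (hsmall₁ : 2 * H₀ * K₁ d * κ₀ * Real.exp (κ - κ₀) ≤ 1) (V : Finset (TPt d N)) (Φ : TPt d N → E) :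
    |Kfield Θ Pol H V Φ| ≤ 2 * Real.exp 1 * K₁ d * κ₀ * H₀ * Real.exp (-(κ - κ₀ - 2) * coverLen Finset.univ V) := by
  have hκ0 : 0 ≤ κ := (le_trans (by positivity) hκv).trans hκ
  have h := simplon_torus (𝕜 := ℝ) Θ hPol hκ₁ hκv hκ hH₀ le_rfl (abs_weight_le_of_mem Θ hH₀ hlog hκ0 hH Φ)
    (by rwa [one_mul]) V
  rw [Real.norm_eq_abs] at h
  exact h

variable [MeasurableSpace E]

/-- **`K^#(Y,Φ′) = ∫ K(Y,Φ′,Φ) dμ_Λ(Φ)`** (L7058–7060) for the ultralocal measure `μ_Λ = ⊗_c ν_c` on the fields `Φ : TPt d N → E`.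
[cite: Dimock2013BalabanII, App. F Theorem cluster3, proof (arXiv:1212.5562v2 TeX L7051–7061)] -/
def Ksharp (ν : TPt d N → MeasureTheory.Measure E) (Θ : Finset (TPt d N)) (Pol : Finset (Finset (TPt d N)))
    (H : Finset (TPt d N) → (TPt d N → E) → ℝ) (V : Finset (TPt d N)) : ℝ :=
  ∫ Φ, Kfield Θ Pol H V Φ ∂(MeasureTheory.Measure.pi ν)

omit [NeZero N] in
/-- `K(V, ·)` is measurable when the `H(X, ·)`, `X ∈ Pol`, are. [cite: Dimock2013BalabanII, App. F Theorem cluster3, proof (arXiv:1212.5562v2 TeX L7025–7035)] -/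
theorem measurable_Kfield (Θ : Finset (TPt d N)) {Pol : Finset (Finset (TPt d N))}
    {H : Finset (TPt d N) → (TPt d N → E) → ℝ} (hHm : ∀ X ∈ Pol, Measurable (H X)) (V : Finset (TPt d N)) :
    Measurable (Kfield Θ Pol H V) := by
  show Measurable fun Φ => ∑ T ∈ covers (fun X : Finset (TPt d N) => X \ Θ) Pol V, ∏ X ∈ T, (Real.exp (H X Φ) - 1)
  refine Finset.measurable_sum _ fun T hT => ?_
  have hTP : T ⊆ Pol := (mem_covers.1 hT).1
  exact Finset.measurable_prod _ fun X hX => (Real.measurable_exp.comp (hHm X (hTP hX))).sub measurable_const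

variable (ν : TPt d N → MeasureTheory.Measure E) [∀ c, MeasureTheory.IsProbabilityMeasure (ν c)]

/-- **`K^#` AGAIN SATISFIES THE BOUND (simplon)** (L7061): `|K^#(V)| ≤ 2eK₁(d)κ₀H₀e^{−(κ−κ₀−2)·coverLen univ V}` — the pointwise
bound passes through the probability integral (`UltralocalFactorization.abs_integral_le_of_abs_le`). [cite: Dimock2013BalabanII, App. F Theorem cluster3, proof (arXiv:1212.5562v2 TeX L7051–7061)] -/
theorem abs_Ksharp_le (Θ : Finset (TPt d N)) {Pol : Finset (Finset (TPt d N))}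
    (hPol : ∀ X ∈ Pol, X.Nonempty ∧ TFaceConnected X ∧ DMod Θ X ∧ (X \ Θ).Nonempty)
    {H : Finset (TPt d N) → (TPt d N → E) → ℝ} {κ κ₀ H₀ : ℝ} (hκ₁ : kappa₁ d ≤ κ₀) (hκv : 4 * 2 ^ d ≤ κ₀)
    (hκ : κ₀ ≤ κ) (hH₀ : 0 ≤ H₀) (hlog : H₀ ≤ Real.log 2)
    (hH : ∀ X ∈ Pol, ∀ Φ, |H X Φ| ≤ H₀ * Real.exp (-κ * torusTreeLenMod X Θ))
    (hsmall₁ : 2 * H₀ * K₁ d * κ₀ * Real.exp (κ - κ₀) ≤ 1) (V : Finset (TPt d N)) :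
    |Ksharp ν Θ Pol H V| ≤ 2 * Real.exp 1 * K₁ d * κ₀ * H₀ * Real.exp (-(κ - κ₀ - 2) * coverLen Finset.univ V) := by
  unfold Ksharp
  exact UltralocalFactorization.abs_integral_le_of_abs_le ν fun Φ => abs_Kfield_le Θ hPol hκ₁ hκv hκ hH₀ hlog hH hsmall₁ V Φ

/-- **STEPS 1–2: `Ξ = ∫ exp(Σ_X H(X,Φ′,Φ)) dμ_Λ(Φ) = Σ_{{Y_j}} Π_j K^#(Y_j,Φ′)`** (L7025–7029 + L7051–7061): the Mayer
expansion at each field (Part 4's `exp_sum_eq_mayer_of_pol`), the finite sum taken out of the integral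
(`MeasureTheory.integral_finsetSum`; each product is bounded — (simplon) at each field — and measurable, hence integrable
against the probability measure), and the FACTORISATION over the Ω-disjoint parts by independence
(`UltralocalFactorization.integral_prod_polymers`: the `Y_j ∩ Ω` pairwise disjoint, `K(Y_j, ·)` depending on the field only
in `Y_j ∩ Λ`). [cite: Dimock2013BalabanII, App. F Theorem cluster3, proof (arXiv:1212.5562v2 TeX L7025–7035, L7051–7061)] -/
theorem integral_exp_sum_eq_sum_famD (Θ Λ : Finset (TPt d N)) (hΛ : Disjoint Λ Θ) {Pol : Finset (Finset (TPt d N))}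
    (hPol : ∀ X ∈ Pol, X.Nonempty ∧ TFaceConnected X ∧ DMod Θ X ∧ (X \ Θ).Nonempty)
    {H : Finset (TPt d N) → (TPt d N → E) → ℝ} {κ κ₀ H₀ : ℝ} (hκ₁ : kappa₁ d ≤ κ₀) (hκv : 4 * 2 ^ d ≤ κ₀)
    (hκ : κ₀ ≤ κ) (hH₀ : 0 ≤ H₀) (hlog : H₀ ≤ Real.log 2) (hHm : ∀ X ∈ Pol, Measurable (H X))
    (hHd : ∀ X ∈ Pol, DependsOn (H X) ((X ∩ Λ : Finset (TPt d N)) : Set (TPt d N)))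
    (hH : ∀ X ∈ Pol, ∀ Φ, |H X Φ| ≤ H₀ * Real.exp (-κ * torusTreeLenMod X Θ))
    (hsmall₁ : 2 * H₀ * K₁ d * κ₀ * Real.exp (κ - κ₀) ≤ 1) :
    ∫ Φ, Real.exp (∑ X ∈ Pol, H X Φ) ∂(MeasureTheory.Measure.pi ν) =
      ∑ 𝒴 ∈ famD (fun X : Finset (TPt d N) => X \ Θ) Pol, ∏ V ∈ 𝒴, Ksharp ν Θ Pol H V := by
  classical
  -- step 1 at each field
  have h1 : (fun Φ : TPt d N → E => Real.exp (∑ X ∈ Pol, H X Φ)) =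
      fun Φ => ∑ 𝒴 ∈ famD (fun X : Finset (TPt d N) => X \ Θ) Pol, ∏ V ∈ 𝒴, Kfield Θ Pol H V Φ := by
    funext Φ
    exact exp_sum_eq_mayer_of_pol (0 : TPt d N) (fun X hX => (hPol X hX).2.2.2) (fun X => H X Φ)
  rw [h1, MeasureTheory.integral_finsetSum _ (fun 𝒴 _ => ?_)]
  · refine Finset.sum_congr rfl fun 𝒴 h𝒴 => ?_
    exact UltralocalFactorization.integral_prod_polymers ν 𝒴 (mem_famD.1 h𝒴).2.1 (Kfield Θ Pol H)
      (fun V _ => measurable_Kfield Θ hHm V) (fun V _ => dependsOn_Kfield Θ Λ hΛ hHd V)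
  · -- integrability: bounded and measurable on a probability space
    refine (MeasureTheory.integrable_const (∏ V ∈ 𝒴,
        2 * Real.exp 1 * K₁ d * κ₀ * H₀ * Real.exp (-(κ - κ₀ - 2) * coverLen Finset.univ V))).mono'
      (Finset.measurable_prod 𝒴 fun V _ => measurable_Kfield Θ hHm V).aestronglyMeasurable
      (Filter.Eventually.of_forall fun Φ => ?_)
    rw [Real.norm_eq_abs, Finset.abs_prod]
    exact Finset.prod_le_prod (fun V _ => abs_nonneg _) fun V _ =>
      abs_Kfield_le Θ hPol hκ₁ hκv hκ hH₀ hlog hH hsmall₁ V Φ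

/-- **THEOREM F.1 (gog2) WITH ITS INTEGRATION STEP** — [Dimock2013BalabanII] App. F, verbatim (L6975–6992): *"Ξ = ∫ exp( Σ_{X ∈
𝒟_k(mod Ω^c), X ∩ Λ ≠ ∅} H(X,Φ′,Φ) ) dμ_Λ(Φ) … Then  Ξ = exp( Σ_{Y} H^#(Y,Φ′) )"* — PROVED on the torus polymer model with
holes for the ultralocal measure `μ_Λ = ⊗_c ν_c` on fields `Φ : TPt d N → E` (reading (vii)): for polymers with holes
`Pol`, measurable `H(X, ·)` depending on the field only through `X ∩ Λ` (`Λ ∩ Θ = ∅`), `|H(X,Φ)| ≤ H₀e^{−κ d_M(X, mod Θ)}`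
for all `Φ`, `0 ≤ H₀ ≤ log 2`, `max(κ₁(d), 4·2^d) ≤ κ₀`, `3κ₀ + 3 ≤ κ`, `2e·K₁(d)²·κ₀·e^{κ}·H₀ ≤ 1`:
`∫ exp(Σ_{X∈Pol} H(X,Φ)) dμ_Λ(Φ) = exp(Σ_V H^#(V))` with `H^#` the App. B kernel's `Hsharp` for the INTEGRATED activities
`K^#(V) = ∫K(V,Φ)dμ_Λ` — steps 1–2 (`integral_exp_sum_eq_sum_famD`), the regrouped sum as the hard-core partition
function (`sum_famD_prod_eq_polymerPartitionFunction`), step 3 by the Kotecký–Preiss theorem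
(`MayerExpansion.polymerPartitionFunction_eq_cexp_sum_Hsharp`) under the KP condition of Part 5a for `K^#`
(`abs_Ksharp_le`). [cite: Dimock2013BalabanII, App. F Theorem cluster3 eq. (gog2) (arXiv:1212.5562v2 TeX L6973–6992)] -/
theorem gog2_integrated (Θ Λ : Finset (TPt d N)) (hΛ : Disjoint Λ Θ) {Pol : Finset (Finset (TPt d N))}
    (hPol : ∀ X ∈ Pol, X.Nonempty ∧ TFaceConnected X ∧ DMod Θ X ∧ (X \ Θ).Nonempty)
    {H : Finset (TPt d N) → (TPt d N → E) → ℝ} {κ κ₀ H₀ : ℝ} (hκ₁ : kappa₁ d ≤ κ₀) (hκv : 4 * 2 ^ d ≤ κ₀)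
    (hκ : 3 * κ₀ + 3 ≤ κ) (hH₀ : 0 ≤ H₀) (hlog : H₀ ≤ Real.log 2) (hHm : ∀ X ∈ Pol, Measurable (H X))
    (hHd : ∀ X ∈ Pol, DependsOn (H X) ((X ∩ Λ : Finset (TPt d N)) : Set (TPt d N)))
    (hH : ∀ X ∈ Pol, ∀ Φ, |H X Φ| ≤ H₀ * Real.exp (-κ * torusTreeLenMod X Θ))
    (hsmall : 2 * Real.exp 1 * K₁ d ^ 2 * κ₀ * Real.exp κ * H₀ ≤ 1) :
    ((∫ Φ, Real.exp (∑ X ∈ Pol, H X Φ) ∂(MeasureTheory.Measure.pi ν) : ℝ) : ℂ) =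
      Complex.exp (∑ V ∈ (unions (fun X : Finset (TPt d N) => X \ Θ) Pol).powerset.image (fun 𝒞 => 𝒞.biUnion id),
        Hsharp (fun X : Finset (TPt d N) => X \ Θ) Pol (fun V => ((Ksharp ν Θ Pol H V : ℝ) : ℂ)) V) := by
  have hκ₀ : 0 ≤ κ₀ := le_trans (by positivity) hκv
  have hκ' : κ₀ ≤ κ := by linarith
  have hδ : 0 ≤ delta d κ κ₀ := by
    have : (0 : ℝ) ≤ 4 * 2 ^ d := by positivity
    have := kappa₁_nonneg d
    simp only [delta]
    linarith
  obtain ⟨hsmall₁, hθ⟩ := smallness_of_single (d := d) hκ₀ hH₀ hsmall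
  have hw : ∀ V ∈ unions (fun X : Finset (TPt d N) => X \ Θ) Pol,
      ‖((Ksharp ν Θ Pol H V : ℝ) : ℂ)‖ ≤
        2 * Real.exp 1 * K₁ d * κ₀ * H₀ * Real.exp (-(κ - κ₀ - 2) * coverLen Finset.univ V) := fun V _ => by
    rw [Complex.norm_real, Real.norm_eq_abs]
    exact abs_Ksharp_le ν Θ hPol hκ₁ hκv hκ' hH₀ hlog hH hsmall₁ V
  rw [integral_exp_sum_eq_sum_famD ν Θ Λ hΛ hPol hκ₁ hκv hκ' hH₀ hlog hHm hHd hH hsmall₁]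
  push_cast
  rw [sum_famD_prod_eq_polymerPartitionFunction (fun V => ((Ksharp ν Θ Pol H V : ℝ) : ℂ)),
    polymerPartitionFunction_eq_cexp_sum_Hsharp (isKPVolume_of_norm_le Θ Pol hκ₀ hδ hH₀ hw hθ)]

/-- **THEOREM F.1 (sunshine) WITH ITS INTEGRATION STEP**: in the setting of `gog2_integrated`, for every Ω-part `V` of the
regrouped gas, `‖H^#(V)‖ ≤ C♯(d,κ₀)·H₀·e^{−(κ − 3κ₀ − 3)·coverLen univ V}` for the `H^#` of the INTEGRATED activities `K^#`
(Part 5a's `sunshine_of_norm_le` with the bound `abs_Ksharp_le`). [cite: Dimock2013BalabanII, App. F Theorem cluster3 eq. (sunshine) (arXiv:1212.5562v2 TeX L6984–6997)] -/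
theorem sunshine_integrated (Θ : Finset (TPt d N)) {Pol : Finset (Finset (TPt d N))}
    (hPol : ∀ X ∈ Pol, X.Nonempty ∧ TFaceConnected X ∧ DMod Θ X ∧ (X \ Θ).Nonempty)
    {H : Finset (TPt d N) → (TPt d N → E) → ℝ} {κ κ₀ H₀ : ℝ} (hκ₁ : kappa₁ d ≤ κ₀) (hκv : 4 * 2 ^ d ≤ κ₀)
    (hκ : 3 * κ₀ + 3 ≤ κ) (hH₀ : 0 ≤ H₀) (hlog : H₀ ≤ Real.log 2)
    (hH : ∀ X ∈ Pol, ∀ Φ, |H X Φ| ≤ H₀ * Real.exp (-κ * torusTreeLenMod X Θ))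
    (hsmall : 2 * Real.exp 1 * K₁ d ^ 2 * κ₀ * Real.exp κ * H₀ ≤ 1)
    {V : Finset (TPt d N)} (hV : V ∈ unions (fun X : Finset (TPt d N) => X \ Θ) Pol) :
    ‖Hsharp (fun X : Finset (TPt d N) => X \ Θ) Pol (fun V => ((Ksharp ν Θ Pol H V : ℝ) : ℂ)) V‖ ≤
      Csharp d κ₀ * H₀ * Real.exp (-(κ - 3 * κ₀ - 3) * coverLen Finset.univ V) := by
  have hκ₀ : 0 ≤ κ₀ := le_trans (by positivity) hκv
  have hκ' : κ₀ ≤ κ := by linarith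
  obtain ⟨hsmall₁, -⟩ := smallness_of_single (d := d) hκ₀ hH₀ hsmall
  have hw : ∀ V ∈ unions (fun X : Finset (TPt d N) => X \ Θ) Pol,
      ‖((Ksharp ν Θ Pol H V : ℝ) : ℂ)‖ ≤
        2 * Real.exp 1 * K₁ d * κ₀ * H₀ * Real.exp (-(κ - κ₀ - 2) * coverLen Finset.univ V) := fun V _ => by
    rw [Complex.norm_real, Real.norm_eq_abs]
    exact abs_Ksharp_le ν Θ hPol hκ₁ hκv hκ' hH₀ hlog hH hsmall₁ V
  exact sunshine_of_norm_le Θ Pol hκ₁ hκv hκ hH₀ hw hsmall hV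

end Integrated

end Literature.MathematicalPhysics.QuantumFieldTheory.Dimock2011to13.ClusterExpansionWithHoles

end
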